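import Literature.MathematicalPhysics.QuantumFieldTheory.Balaban1983to89.Beta.OneStepKernelFamily
import Literature.MathematicalPhysics.QuantumFieldTheory.Balaban1983to89.Beta.HessianTelescopingKKT

/-!
# Bałaban's lattice YM₄ RG programme — β-function sub-cell: `D1Drift` IS INHABITED AND REFUTABLE OVER JET DATA
# (lead lineage strat-b12, gen 10; answers beta-ref v51 ADVISORY A-R394 — the (D1)-side twin of the (R21) vacuity check)
# VERSIONS: v1 p187877 a0271a151251 (§1–§4).  v1.5 (this file, APPEND-ONLY on v1.4 p190068 069f495d446e; §1–§8 byte-identical): §9 (SDA) IS AUTOMATIC —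
# `absMoment₂_dressedSum` (the two-sided dressed kernel of three patterns with absolutely summable second moments has an absolutely summable second
# moment: integer weight `1 + |y|₁²` through beta-an5's triple-family engine `summable_term_of_bound` + `hasSum_coarse`), `absMoment₂_comp_zsmul` (decimation),
# `absMoment₂_dressedEntry`, `absMoment₂_transport`, **`absMoment₂_sd`** (the full step defect has `AbsMoment₂` as soon as the transported one-shot kernel does —
# no hypothesis), and the (SDA)-free forms `d1Sum_iff_sdInvisible'` / `d1Sum_of_sdInvisible` / `d1Drift_of_sdInvisible_D1Rep` of §8.  v1.4 p190068: §8 RULING (R28-1) IN KERNEL —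
# the FULL step defect `SD` of the typed families w.r.t. beta-an4's canonical weight `wStep`, the read-out-level invisibility clause `SDInvisible` ((SDF)),
# `d1Sum_of_stepDefect` (`D1Sum` ⟸ Ward data of the step family + `hbase` + moments of `SD` + (SDF), an4's §9 socket AT `R := SD` with the recursion FREE),
# `sd_wardData_of_families` ((SD0)/(SD1) ⟸ the Ward data of BOTH families), `d1Sum_iff_sdInvisible` ((SDF) is EXACTLY the content of `D1Sum` given those data),
# `d1Drift_of_stepDefect_D1Rep` (the wall's statement from (SDF) + `D1Rep` + the standing data).  v1.3 p189457: §7 THE JET-LEVEL READ-OUT TELESCOPING `D1Sum`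
# (the (D1-tel) binder CUT AT THE READ-OUT LEVEL — lead seam decision on beta-an4 X-an4-38, `ScalewiseVectorSeam` v1.8 §11 `ReadoutSum`): `D1Sum`, `d1Sum_iff`,
# `d1Sum_of_d1Tel` (the v1 route implies it), `d1Rep_iff_d1Drift_of_d1Sum` / `d1Drift_of_d1Sum_D1Rep` (NO hW/hR, NO `D1Tel` at the seam); §1–§6 byte-identical.
# v1.2 p189127: §6 THE UNITS PIN of RULING (R25-1)(ii) / beta-ref
# A-R428, v57 R433 (iii) — the bond-unit step response `respBond` (R̂_j) IS `Lc^{d+1} •` beta-an4's canonical weight `HessianTelescopingKKT.wStep` (reflected-translated), their `Lc`-coset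
# masses are `Lc^{−1}` resp. `Lc^{−5}`, and `StepRecursion … (wStep Lc)` IS the prefactor-free two-leg transport with `R̂`-normalised legs (`stepRecursion_wStep_iff`); new import
# `…Beta.HessianTelescopingKKT` (imports `OneStepKernelFamily` only); §1–§5 byte-identical.  v1.1 p188631: §5 `d1Rep_iff_d1Drift` / `d1Rep_of_d1Drift` — RULING (R24)'s «`D1Rep ⟺ D1Drift`» AS A
# KERNEL IFF AT THE TYPED OBJECTS (beta-ref v54 R419 (b)): given the route data (hW/hR on `flipK (TbalOf Lc Js j)`, `D1Tel Lc Js Jc`, h12/h126 by name, labels,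
# window data), `OneStepKernelFamily.D1Rep Lc Jc N μ ν a SL k ↔ OneStepKernelFamily.D1Drift Lc Js N μ ν` — the lead's `ScalewiseVectorSeam.d1Rep_iff_oneLoopDrift` (v1.6 §9)
# instantiated at `T := TbalOf Lc Js`, `𝒯 := TshotOf Lc Jc`, `Sβ := splitOf (secondMoment ∘ TbalOf Lc Js)`; the converse of an2's `d1Drift_of_D1Tel_D1Rep` by name.

HONEST FRAMING (cell rule, verbatim): «discharging `BetaPertH` makes Bałaban's UV stability UNCONDITIONAL — a real constructive-QFT
result; it is NOT the continuum limit and NOT the Clay problem.»  This module DISCHARGES NOTHING of the wall: it is a [folklore]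
CERTIFICATE about the TYPED objects of an2's `OneStepKernelFamily` (P2).  RULING (R23) states the located one-loop estimate of the cell
as the closed Prop `OneStepKernelFamily.D1Drift Lc Js N μ ν := ∃ A, OneLoopDrift (stepBal N Lc) A (fun j => secondMoment (TbalOf Lc Js j) μ ν)`
over the step jet data `Js`; the referee (REFEREE-BETA v50 R388 (v), v51 A-R394) asked for a kernel proof that this predicate is neither
vacuous nor degenerate.  Here: for every block size `Lc`, EVERY real sequence is realised as the sequence of `(μ, ν)` second moments of
the typed step kernels `TbalOf Lc Js j` of SOME jet data (`exists_jetData_secondMoment_eq`), hence `D1Drift` is INHABITED for every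
`(N, μ, ν)` (`d1Drift_inhabited`) and REFUTABLE whenever the slope `stepBal N Lc ≠ 0` (`exists_jetData_not_d1Drift`): its truth is a
property of WHICH jet data — of Bałaban's stencils (item (i′) of EXIT-B; its proof there is EXIT-A) — exactly as R388 (v) reads it.
The analytic input is a NON-DEGENERACY of the typed objects: the `ℋ`-block (field ← prescribed average) of the decimated composite
resolvent `KInvStep Lc j` averages to the identity over an `Lc`-block contour (§2: composition of block-contour sums, §1, with
`KernelSpecInstance.wH_Q`, i.e. `𝒬ℋ = 1` at blocking `Lc^(j+1)`), so it has a non-zero entry, which a matrix-unit second-order vertex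
reads off through the tadpole (§3).  NOT summit progress.

## Contents ([folklore]; 0 cited facts; 0 `def … : Prop`)

* §1 `sum_range_digit`, `sum_box_digit`, `contourSum_compose`: `Σ_{b′ ∈ [0,L)^{D}, s′<L} contourSum M A κ (b′ + s′e_κ) = contourSum (ML) A κ 0`
  — the finite bookkeeping behind [Balaban1984PropagatorsI] p. 20 (1.16)–(1.18) «Q₂ is defined as Q only with the number L replaced by L²»
  (orientation only; nothing printed is used).
* §2 `dec_inl_inr`, `KInvStep_inl_inr_zero` (the `(inl κ, inr l)` entries of `KInvStep Lc j` at the coarse point `0` are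
  `(Lc^j)^{−(d+2)} · contourSum (Lc^j) ℋ`), `sum_KInvStep_inl_inr` (`= (Lc^j)^{−(d+2)}` summed over the `Lc`-block contour),
  `exists_KInvStep_ne_zero`.
* §3 matrix units: `comp_smul_unitKer`, `tadpole_smul_unitKer` (`Tr[A ∘ c·E_{(P,a₀),(Q,b₀)}] = c · A (Q,b₀) (P,a₀)`), `tadpole_zero`,
  `bubble_zero`, `biLoc_smul_unitKer`.
* §4 the witness jet datum `jetW` (zero first-order stencil, scaled matrix-unit second-order vertex at the bond pair `(0, z⋆)`,
  `z⋆ := e_μ + e_ν`): `TstepOf_jetW` (the typed step kernel is supported at `z⋆`), `secondMoment_TstepOf_jetW`,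
  **`exists_jetData_secondMoment_TstepOf_eq`** / **`exists_jetData_secondMoment_eq`** (PRESCRIBED MOMENTS, any dimension / `d + 1 = 4`),
  **`d1Drift_inhabited`**, **`exists_jetData_not_d1Drift`**, `exists_jetData_secondMoment_ne_zero`, `d1Drift_genuine`,
  `exists_d1Drift_N_ne_zero` (the advisory's literal form).

The witness data are NOT translation-covariant and are nobody's stencils: a satisfiability certificate, like `Beta/WallWitness` /
`Beta/ScalewiseWitness` on the socket side.

* §5 (v1.1) **`d1Rep_iff_d1Drift`**, `d1Rep_of_d1Drift`: under the proof-route data of `OneStepKernelFamily.d1Drift_of_D1Tel_D1Rep` (printed Ward identity and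
  reflection covariance asked of `flipK (TbalOf Lc Js j)`, `D1Tel Lc Js Jc`, the two (α)-leaves h12/h126 BY NAME, base-point labels, window data) the representation
  binder and the drift are EQUIVALENT: `D1Rep Lc Jc N μ ν a SL k ↔ D1Drift Lc Js N μ ν`.  So the census row (D1) carries ONE statement (`D1Drift`, RULING (R23)), of
  which `D1Rep` is the proof-route form (RULING (R24)); neither is proved here for Bałaban's jets.
* §6 (v1.2) **THE UNITS PIN** (RULING (R25-1)(ii), beta-an2 ANSWER (A2) journal l.53794, beta-an4 X-an4-37, beta-ref A-R428 / v57 R433 (iii)).  Two spellings of ONE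
  step response were in use: the bond-unit response `R̂_j a y c u := Lc^((d+2)j+(d+1)) · colH (KInvStep Lc j) Lc a y c u` fed to the composite jets (`InterLevelTransport.transportV`'s
  slot; `Lc`-coset mass `Lc^{−1}`) and beta-an4's canonical weight `wStep Lc j c a p := Lc^{5j} · KInvStep Lc j (−p) 0 (inl c) (inr a)` of `StepRecursion` (mass `Lc^{−5}`, with the
  bond-unit prefactor `Lc^8` of `DressedMomentNormalisation` §3).  Here (`d = 3`): `respBond` (R̂_j literally), **`respBond_eq_wStep`** `R̂_j a y c u = Lc^4 · wStep Lc j c a (Lc•y − u)`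
  (block covariance `OneStepKernelFamily.shiftK_KInvStep`), `wStep_eq_respBond`, `constReproSum_reflect`, **`constReproSum_respBond`** (mass `Lc^{−1}` at every `j`) against
  `HessianTelescopingKKT.constReproSum_wStep` (mass `Lc^{−5}`), `dressedEntry_const_mul` (the two-leg transport is quadratic in the weight), `bondW := Lc^4 • wStep` = `respBond` read as an
  `EKer` (`bondW_eq_respBond`, `constReproSum_bondW`), and **`stepRecursion_wStep_iff`**: `StepRecursion Lc T 𝒯 (wStep Lc) ↔ ∀ j ≥ 1, 𝒯 (j+1) a b z = dressedEntry (bondW Lc j) (𝒯 j) (Lc•z) a b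
  + T j a b z` — the prefactor `Lc^8 = Lc^{2·4}` IS one factor `Lc^{d+1}` on each response leg.  Hence (R1) is STATED with `w = wStep Lc` (the only typed consumer,
  `HessianTelescopingKKT.d1Tel_of_stepRecursion_wStep`), `R̂_j` is the jets-side name of the same response, and no `EntryHyps` is ever asked of `R̂_j`: ONE convention, by name.* §7 (v1.3) **THE JET-LEVEL READ-OUT TELESCOPING `D1Sum Lc Js Jc μ ν`** := `ScalewiseVectorSeam.ReadoutSum (secondMoment (TbalOf Lc Js ·) μ ν) (TshotOf Lc Jc) μ ν`:
  for every `m ≥ 1`, `Σ_{j<m} secondMoment (TbalOf Lc Js j) μ ν = secondMoment (TshotOf Lc Jc m) μ ν` — the WEAKEST telescoping binder the wall consumes (beta-an4 X-an4-38).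
  `d1Sum_of_d1Tel`: `D1Tel Lc Js Jc` + the route's Ward/reflection data of `flipK (TbalOf Lc Js j)` imply it; **`d1Rep_iff_d1Drift_of_d1Sum`** / **`d1Drift_of_d1Sum_D1Rep`**:
  GIVEN `D1Sum`, `D1Rep Lc Jc N μ ν a SL k ↔ D1Drift Lc Js N μ ν` with NO hW/hR and NO `D1Tel` among the binders — so a proof route may deliver P6 at the read-out
  level (an4 `HessianTelescopingKKT` v1.3 `flowSum_of_stepRecursionUpTo_wStep` at `F := readout122 μ ν`, with RULING (R26-2)'s P6c at that level) and close (D1) as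
  `D1Drift` ⟸ {`D1Sum`, `D1Rep`}; the wall statement `D1Drift Lc (JsBal N Lc) N μ ν` is unchanged.
-/

open Finset
open scoped BigOperators
open Literature.Probability.LatticeModels (TorusSite Torus.proj Torus.proj_apply)
open Literature.MathematicalPhysics.QuantumFieldTheory.Balaban1983to89
open Literature.MathematicalPhysics.QuantumFieldTheory.Balaban1983to89.Beta
open B12Sec2to5 (l1 l1_nonneg)
open DressedMomentNormalisation (EKer)
open B12Beta (secondMoment)
open AffineAveraging (toSite unitVec contourSum Form1)
open KernelSpecInstance (wH wH_Q)
open ExpKernelCalculus (MKer BiLoc VertexFamily₂ hessKer comp tr tadpole bubble)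
open OneStepResolventKernel (Fib KInv KInv_inl_inr_coarse wsum LocStencil JetData)
open Drift (OneLoopDrift)
open OneStepKernelFamily (LegIdx legSet legPt legW dec KInvStep colH vertexOfK TstepOf TbalOf D1Drift)

namespace Literature.MathematicalPhysics.QuantumFieldTheory.Balaban1983to89.Beta.StepDriftWitness

variable {d : ℕ}

/-! ## §1 Composition of block-contour sums (digit decomposition) -/

section Compose

/-- ONE-DIMENSIONAL DIGIT DECOMPOSITION of a range sum: `Σ_{s′<L} Σ_{s<M} g (M s′ + s) = Σ_{S<ML} g S` (`0 < M`). [folklore] -/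
theorem sum_range_digit (M L : ℕ) (hM : 0 < M) (g : ℕ → ℝ) :
    ∑ s' ∈ range L, ∑ s ∈ range M, g (M * s' + s) = ∑ S ∈ range (M * L), g S := by
  rw [← Finset.sum_product']
  refine Finset.sum_nbij' (fun p => M * p.1 + p.2) (fun S => (S / M, S % M)) ?_ ?_ ?_ ?_ ?_
  · intro p hp
    simp only [Finset.mem_product, Finset.mem_range] at hp ⊢
    calc M * p.1 + p.2 < M * p.1 + M := by omega
      _ = M * (p.1 + 1) := by ring
      _ ≤ M * L := Nat.mul_le_mul_left _ hp.1
  · intro S hS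
    simp only [Finset.mem_product, Finset.mem_range] at hS ⊢
    refine ⟨(Nat.div_lt_iff_lt_mul hM).2 (by rw [Nat.mul_comm]; exact hS), Nat.mod_lt _ hM⟩
  · intro p hp
    simp only [Finset.mem_product, Finset.mem_range] at hp
    refine Prod.ext ?_ ?_
    · show (M * p.1 + p.2) / M = p.1
      rw [Nat.mul_add_div hM, Nat.div_eq_of_lt hp.2, add_zero]
    · show (M * p.1 + p.2) % M = p.2
      rw [Nat.mul_add_mod, Nat.mod_eq_of_lt hp.2]
  · intro S _
    exact Nat.div_add_mod S M
  · intro p _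
    rfl

/-- MULTI-DIMENSIONAL DIGIT DECOMPOSITION of a box sum: `Σ_{b′ ∈ [0,L)^D} Σ_{r ∈ [0,M)^D} G (M b′ + r) = Σ_{B ∈ [0,ML)^D} G B`
(`0 < M`). [folklore] -/
theorem sum_box_digit {D : ℕ} (M L : ℕ) (hM : 0 < M) (G : (Fin D → ℕ) → ℝ) :
    ∑ b' ∈ AffineAveraging.box D L, ∑ r ∈ AffineAveraging.box D M, G (fun i => M * b' i + r i) = ∑ B ∈ AffineAveraging.box D (M * L), G B := by
  rw [← Finset.sum_product']
  refine Finset.sum_nbij' (fun p => fun i => M * p.1 i + p.2 i) (fun B => (fun i => B i / M, fun i => B i % M))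
    ?_ ?_ ?_ ?_ ?_
  · intro p hp
    simp only [AffineAveraging.box, Finset.mem_product, Fintype.mem_piFinset, Finset.mem_range] at hp ⊢
    intro i
    calc M * p.1 i + p.2 i < M * p.1 i + M := by have := hp.2 i; omega
      _ = M * (p.1 i + 1) := by ring
      _ ≤ M * L := Nat.mul_le_mul_left _ (hp.1 i)
  · intro B hB
    simp only [AffineAveraging.box, Finset.mem_product, Fintype.mem_piFinset, Finset.mem_range] at hB ⊢
    exact ⟨fun i => (Nat.div_lt_iff_lt_mul hM).2 (by rw [Nat.mul_comm]; exact hB i), fun i => Nat.mod_lt _ hM⟩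
  · intro p hp
    simp only [AffineAveraging.box, Finset.mem_product, Fintype.mem_piFinset, Finset.mem_range] at hp
    refine Prod.ext ?_ ?_
    · funext i
      show (M * p.1 i + p.2 i) / M = p.1 i
      rw [Nat.mul_add_div hM, Nat.div_eq_of_lt (hp.2 i), add_zero]
    · funext i
      show (M * p.1 i + p.2 i) % M = p.2 i
      rw [Nat.mul_add_mod, Nat.mod_eq_of_lt (hp.2 i)]
  · intro B _
    funext i
    exact Nat.div_add_mod (B i) M
  · intro p _
    rfl

/-- Leg-point bookkeeping: `M•(b′ + s′e_κ) + r + s e_κ = (M b′ + r) + (M s′ + s) e_κ`. [folklore] -/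
theorem digit_point {D : ℕ} (M : ℕ) (κ : Fin D) (b' r : Fin D → ℕ) (s' s : ℕ) :
    (M : ℤ) • (toSite b' + (s' : ℤ) • unitVec κ) + toSite r + (s : ℤ) • unitVec κ
      = toSite (fun i => M * b' i + r i) + ((M * s' + s : ℕ) : ℤ) • unitVec κ := by
  funext i
  simp only [toSite, unitVec, Pi.add_apply, Pi.smul_apply, Pi.single_apply, smul_eq_mul]
  split_ifs <;> push_cast <;> ring

/-- **COMPOSITION OF BLOCK-CONTOUR SUMS** (the finite bookkeeping behind «`Q_L` composed `m` times is `Q_{L^m}`»): summing the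
`M`-contour sums over the `L`-block contour of the coarse lattice gives the `ML`-contour sum. [folklore] -/
theorem contourSum_compose {D : ℕ} (M L : ℕ) (hM : 0 < M) (A : Form1 D ℝ) (κ : Fin D) :
    ∑ b' ∈ AffineAveraging.box D L, ∑ s' ∈ range L, contourSum M A κ (toSite b' + (s' : ℤ) • unitVec κ) = contourSum (M * L) A κ 0 := by
  simp only [contourSum, smul_zero, zero_add, digit_point]
  calc ∑ b' ∈ AffineAveraging.box D L, ∑ s' ∈ range L, ∑ r ∈ AffineAveraging.box D M, ∑ s ∈ range M,
          A κ (toSite (fun i => M * b' i + r i) + ((M * s' + s : ℕ) : ℤ) • unitVec κ)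
      = ∑ b' ∈ AffineAveraging.box D L, ∑ r ∈ AffineAveraging.box D M, ∑ s' ∈ range L, ∑ s ∈ range M,
          A κ (toSite (fun i => M * b' i + r i) + ((M * s' + s : ℕ) : ℤ) • unitVec κ) :=
        Finset.sum_congr rfl fun _ _ => Finset.sum_comm
    _ = ∑ b' ∈ AffineAveraging.box D L, ∑ r ∈ AffineAveraging.box D M, ∑ S ∈ range (M * L), A κ (toSite (fun i => M * b' i + r i) + (S : ℤ) • unitVec κ) :=
        Finset.sum_congr rfl fun b' _ => Finset.sum_congr rfl fun r _ =>
          sum_range_digit M L hM (fun S => A κ (toSite (fun i => M * b' i + r i) + (S : ℤ) • unitVec κ))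
    _ = ∑ B ∈ AffineAveraging.box D (M * L), ∑ S ∈ range (M * L), A κ (toSite B + (S : ℤ) • unitVec κ) :=
        sum_box_digit M L hM (fun B => ∑ S ∈ range (M * L), A κ (toSite B + (S : ℤ) • unitVec κ))

end Compose


/-! ## §2 The `ℋ`-block of the decimated composite resolvent averages to the identity; hence it is not zero -/

section HBlock

variable {Lc : ℕ} [NeZero Lc]

/-- The MIXED (field, multiplier) entries of a decimated kernel: the field leg is the `M`-block-contour average, the multiplier leg
is read at the coarse point. [folklore] -/
theorem dec_inl_inr (M : ℕ) (K : MKer (d + 1) (Fib d)) (κ l : Fin (d + 1)) (x' y' : Fin (d + 1) → ℤ) :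
    dec M K x' y' (Sum.inl κ) (Sum.inr l)
      = ((M : ℝ) ^ (d + 2))⁻¹ * ∑ i ∈ LegIdx d M, K (legPt M (Sum.inl κ) x' i) ((M : ℤ) • y') (Sum.inl κ) (Sum.inr l) := by
  simp only [dec, legSet, legW, Finset.sum_singleton, mul_one, Finset.mul_sum]
  rfl

/-- A field-leg point of the decimation is a point of the straight `M`-contour: `legPt M (inl κ) x′ (r, s) = M•x′ + r + s e_κ`.
[folklore] -/
theorem legPt_inl_eq (M : ℕ) (κ : Fin (d + 1)) (x' : Fin (d + 1) → ℤ) (i : (Fin (d + 1) → ℕ) × ℕ) :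
    legPt M (Sum.inl κ) x' i = (M : ℤ) • x' + toSite i.1 + (i.2 : ℤ) • unitVec κ := by
  funext jj
  simp only [legPt, toSite, unitVec, Pi.add_apply, Pi.smul_apply, Pi.single_apply, smul_eq_mul, mul_ite, mul_one, mul_zero]
  ring

/-- The field-leg sum of the decimation IS the straight-contour block sum `AffineAveraging.contourSum`. [folklore] -/
theorem sum_LegIdx_eq_contourSum (M : ℕ) (κ : Fin (d + 1)) (A : Form1 (d + 1) ℝ) (x' : Fin (d + 1) → ℤ) :
    ∑ i ∈ LegIdx d M, A κ (legPt M (Sum.inl κ) x' i) = contourSum M A κ x' := by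
  rw [LegIdx, Finset.sum_product]
  simp only [contourSum, legPt_inl_eq]
  rfl

/-- **THE `ℋ`-ENTRIES OF THE DECIMATED COMPOSITE RESOLVENT** at the coarse point `0`: the `Lc^j`-block-contour average of the
composite minimiser kernel `wH` at blocking `Lc^(j+1)`. [folklore] -/
theorem KInvStep_inl_inr_zero (j : ℕ) (κ l : Fin (d + 1)) (x' : Fin (d + 1) → ℤ) :
    KInvStep (d := d) Lc j x' 0 (Sum.inl κ) (Sum.inr l)
      = (((Lc ^ j : ℕ) : ℝ) ^ (d + 2))⁻¹ * contourSum (Lc ^ j) (fun κ' z => wH (N := Lc ^ (j + 1)) κ' l z) κ x' := by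
  unfold KInvStep
  rw [dec_inl_inr, smul_zero, ← sum_LegIdx_eq_contourSum]
  congr 1
  refine Finset.sum_congr rfl fun i _ => ?_
  have h := KInv_inl_inr_coarse (N := Lc ^ (j + 1)) κ l (legPt (Lc ^ j) (Sum.inl κ) x' i) 0
  rw [smul_zero, sub_zero] at h
  exact h

/-- **THE `ℋ`-BLOCK AVERAGES TO THE IDENTITY**: summed over the `Lc`-block contour of the step-`j` lattice at the origin, the
`(inl κ, inr κ)` entries of `KInvStep Lc j` give `(Lc^j)^{−(d+2)}` — composition of block-contour sums (§1) and `𝒬ℋ = 1` at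
blocking `Lc^(j+1)` (`KernelSpecInstance.wH_Q`). [folklore] -/
theorem sum_KInvStep_inl_inr (j : ℕ) (κ : Fin (d + 1)) :
    ∑ b' ∈ AffineAveraging.box (d + 1) Lc, ∑ s' ∈ range Lc,
        KInvStep (d := d) Lc j (toSite b' + (s' : ℤ) • unitVec κ) 0 (Sum.inl κ) (Sum.inr κ)
      = (((Lc ^ j : ℕ) : ℝ) ^ (d + 2))⁻¹ := by
  simp only [KInvStep_inl_inr_zero, ← Finset.mul_sum]
  have hM : 0 < Lc ^ j := pow_pos (Nat.pos_of_ne_zero (NeZero.ne Lc)) j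
  rw [contourSum_compose (Lc ^ j) Lc hM (fun κ' z => wH (N := Lc ^ (j + 1)) κ' κ z) κ, ← pow_succ, wH_Q]
  simp

/-- **THE DECIMATED COMPOSITE RESOLVENT IS NOT ZERO**: some `(inl κ, inr κ)` entry at the coarse point `0` is non-zero. [folklore] -/
theorem exists_KInvStep_ne_zero (j : ℕ) (κ : Fin (d + 1)) :
    ∃ x' : Fin (d + 1) → ℤ, KInvStep (d := d) Lc j x' 0 (Sum.inl κ) (Sum.inr κ) ≠ 0 := by
  have hne : ∑ b' ∈ AffineAveraging.box (d + 1) Lc, ∑ s' ∈ range Lc,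
      KInvStep (d := d) Lc j (toSite b' + (s' : ℤ) • unitVec κ) 0 (Sum.inl κ) (Sum.inr κ) ≠ 0 := by
    rw [sum_KInvStep_inl_inr]
    have hL : (0 : ℝ) < ((Lc ^ j : ℕ) : ℝ) := by exact_mod_cast pow_pos (Nat.pos_of_ne_zero (NeZero.ne Lc)) j
    positivity
  obtain ⟨b', _, hb'⟩ := Finset.exists_ne_zero_of_sum_ne_zero hne
  obtain ⟨s', _, hs'⟩ := Finset.exists_ne_zero_of_sum_ne_zero hb'
  exact ⟨_, hs'⟩

end HBlock

/-! ## §3 Matrix-unit second-order vertices: the tadpole extracts one entry; zero first-order data -/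

section Unit

variable {D : ℕ} {F : Type*}

section Zero

variable [Fintype F]

/-- Composition with the zero kernel vanishes. [folklore] -/
theorem comp_zero_right (A : MKer D F) : comp A 0 = 0 := by
  funext x z a b
  simp only [comp, Pi.zero_apply, mul_zero, Finset.sum_const_zero, tsum_zero]

/-- The tadpole of the zero vertex vanishes. [folklore] -/
theorem tadpole_zero (A : MKer D F) : tadpole A 0 = 0 := by
  simp only [tadpole, comp_zero_right, tr, Pi.zero_apply, Finset.sum_const_zero, tsum_zero]

/-- The bubble of two zero vertices vanishes. [folklore] -/
theorem bubble_zero (A : MKer D F) : bubble A 0 0 = 0 := by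
  simp only [bubble, comp_zero_right, tr, Pi.zero_apply, Finset.sum_const_zero, tsum_zero]

end Zero

variable [DecidableEq F]

/-- The MATRIX UNIT kernel with the single entry `1` at row `(P, a₀)`, column `(Q, b₀)`. [folklore] -/
def unitKer (P Q : Fin D → ℤ) (a₀ b₀ : F) : MKer D F :=
  fun x y a b => if x = P ∧ y = Q ∧ a = a₀ ∧ b = b₀ then 1 else 0

/-- A scaled matrix unit is bi-localised at ANY pair of reference points, with any rate, for an explicit constant. [folklore] -/
theorem biLoc_smul_unitKer (c : ℝ) (P Q p q : Fin D → ℤ) (a₀ b₀ : F) (δ : ℝ) :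
    BiLoc (c • unitKer P Q a₀ b₀) p q (|c| * Real.exp (δ * (l1 (P - p) + l1 (Q - q)))) δ := by
  intro x y a b
  simp only [Pi.smul_apply, smul_eq_mul, unitKer]
  split_ifs with h
  · obtain ⟨rfl, rfl, -, -⟩ := h
    rw [mul_one, mul_assoc, ← Real.exp_add, neg_mul, add_neg_cancel, Real.exp_zero, mul_one]
  · rw [mul_zero, abs_zero]
    positivity

variable [Fintype F]

/-- Composition with a scaled matrix unit picks one column of `A`. [folklore] -/
theorem comp_smul_unitKer (A : MKer D F) (c : ℝ) (P Q : Fin D → ℤ) (a₀ b₀ : F) (x z : Fin D → ℤ) (a b : F) :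
    comp A (c • unitKer P Q a₀ b₀) x z a b = if z = Q ∧ b = b₀ then c * A x P a a₀ else 0 := by
  simp only [comp, Pi.smul_apply, smul_eq_mul, unitKer]
  rw [tsum_eq_single P]
  · simp only [true_and]
    by_cases hz : z = Q ∧ b = b₀
    · simp only [hz, and_true, true_and, if_true, mul_ite, mul_one, mul_zero]
      rw [Finset.sum_ite_eq' Finset.univ a₀]
      simp only [Finset.mem_univ, if_true]
      ring
    · simp only [hz, if_false]
      refine Finset.sum_eq_zero fun f _ => ?_
      have : ¬(z = Q ∧ f = a₀ ∧ b = b₀) := fun h => hz ⟨h.1, h.2.2⟩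
      simp only [this, if_false, mul_zero]
  · intro y hy
    refine Finset.sum_eq_zero fun f _ => ?_
    simp only [hy, false_and, if_false, mul_zero]

/-- **THE TADPOLE OF A SCALED MATRIX UNIT IS ONE ENTRY**: `Tr[A ∘ (c·E_{(P,a₀),(Q,b₀)})] = c · A (Q,b₀) (P,a₀)`. [folklore] -/
theorem tadpole_smul_unitKer (A : MKer D F) (c : ℝ) (P Q : Fin D → ℤ) (a₀ b₀ : F) :
    tadpole A (c • unitKer P Q a₀ b₀) = c * A Q P b₀ a₀ := by
  simp only [tadpole, tr, comp_smul_unitKer]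
  rw [tsum_eq_single Q]
  · simp only [true_and]
    rw [Finset.sum_ite_eq' Finset.univ b₀]
    simp only [Finset.mem_univ, if_true]
  · intro x hx
    refine Finset.sum_eq_zero fun a _ => ?_
    simp only [hx, false_and, if_false]

end Unit

/-! ## §4 Jet data with PRESCRIBED second moments; `D1Drift` is inhabited and refutable over jet data -/

section Witness

variable {Lc : ℕ} [NeZero Lc]

/-- The ZERO first-order stencil family. [folklore] -/
def zeroStencil (d : ℕ) : Fin (d + 1) → (Fin (d + 1) → ℤ) → MKer (d + 1) (Fib d) := fun _ _ => 0

/-- The zero stencil is (trivially) local. [folklore] -/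
theorem locStencil_zero (δ : ℝ) : LocStencil (zeroStencil d) 0 δ := by
  intro κ' u x y a b
  simp only [zeroStencil, Pi.zero_apply, abs_zero, zero_mul, le_refl]

/-- The chain-rule vertex of the zero stencil vanishes, whatever the packed resolvent. [folklore] -/
theorem vertexOfK_zeroStencil (K : MKer (d + 1) (Fib d)) (N : ℕ) : vertexOfK K N (zeroStencil d) = fun _ _ => 0 := by
  funext μ y x z a b
  simp only [vertexOfK, wsum, zeroStencil, Pi.zero_apply, mul_zero, tsum_zero, Finset.sum_const_zero]

/-- The support point `z⋆ := e_μ + e_ν` of the witness kernels. [folklore] -/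
def zstar (μ ν : Fin (d + 1)) : Fin (d + 1) → ℤ := unitVec μ + unitVec ν

/-- `1 ≤ z⋆_μ`. [folklore] -/
theorem one_le_zstar_left (μ ν : Fin (d + 1)) : (1 : ℤ) ≤ zstar μ ν μ := by
  simp only [zstar, unitVec, Pi.add_apply, Pi.single_apply, if_true]
  split_ifs <;> omega

/-- `1 ≤ z⋆_ν`. [folklore] -/
theorem one_le_zstar_right (μ ν : Fin (d + 1)) : (1 : ℤ) ≤ zstar μ ν ν := by
  simp only [zstar, unitVec, Pi.add_apply, Pi.single_apply, if_true]
  split_ifs <;> omega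

/-- The cast components `z⋆_μ`, `z⋆_ν` are non-zero reals. [folklore] -/
theorem zstar_cast_ne_zero (μ ν : Fin (d + 1)) :
    ((zstar μ ν μ : ℤ) : ℝ) ≠ 0 ∧ ((zstar μ ν ν : ℤ) : ℝ) ≠ 0 := by
  have h1 : (1 : ℝ) ≤ ((zstar μ ν μ : ℤ) : ℝ) := by exact_mod_cast one_le_zstar_left μ ν
  have h2 : (1 : ℝ) ≤ ((zstar μ ν ν : ℤ) : ℝ) := by exact_mod_cast one_le_zstar_right μ ν
  exact ⟨by positivity, by positivity⟩

/-- The WITNESS SECOND-ORDER VERTEX FAMILY: at the base bond pair `(y, y′) = (0, z⋆)` the scaled matrix unit reading the entry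
`K Q 0 (inl κ) (inr κ)` of the resolvent, zero elsewhere. [folklore] -/
noncomputable def unitW (Q zs : Fin (d + 1) → ℤ) (κ : Fin (d + 1)) (c : ℝ) :
    Fin (d + 1) → (Fin (d + 1) → ℤ) → Fin (d + 1) → (Fin (d + 1) → ℤ) → MKer (d + 1) (Fib d) :=
  fun _ y _ y' => if y = 0 ∧ y' = zs then c • unitKer 0 Q (Sum.inr κ) (Sum.inl κ) else 0

/-- The witness second-order family is a vertex family (bi-localised at the coarse bonds) for an explicit constant. [folklore] -/
theorem vertexFamily₂_unitW (N : ℕ) (Q zs : Fin (d + 1) → ℤ) (κ : Fin (d + 1)) (c δ : ℝ) :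
    VertexFamily₂ (unitW (d := d) Q zs κ c) N (|c| * Real.exp (δ * l1 (Q - (N : ℤ) • zs))) δ := by
  intro μ y ν y'
  by_cases h : y = 0 ∧ y' = zs
  · rw [show unitW (d := d) Q zs κ c μ y ν y' = c • unitKer 0 Q (Sum.inr κ) (Sum.inl κ) by
      simp only [unitW, h, and_self, if_true], h.1, h.2, smul_zero]
    have h0 : l1 ((0 : Fin (d + 1) → ℤ) - 0) = 0 := by simp [l1]
    have hb := biLoc_smul_unitKer c 0 Q 0 ((N : ℤ) • zs) (Sum.inr κ : Fib d) (Sum.inl κ) δ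
    rw [h0, zero_add] at hb
    exact hb
  · intro x yy a b
    simp only [unitW, h, if_false, Pi.zero_apply, abs_zero]
    positivity

/-- THE WITNESS JET DATUM: zero first-order stencil, the scaled matrix-unit second-order vertex. [folklore] -/
noncomputable def jetW (Lc : ℕ) [NeZero Lc] (Q zs : Fin (d + 1) → ℤ) (κ : Fin (d + 1)) (c : ℝ) : JetData d Lc where
  S := zeroStencil d
  W := unitW Q zs κ c
  Cs := 0
  Cw := |c| * Real.exp (1 * l1 (Q - (Lc : ℤ) • zs))
  δ := 1
  δ_pos := one_pos
  loc := locStencil_zero 1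
  loc₂ := vertexFamily₂_unitW Lc Q zs κ c 1

/-- **THE TYPED STEP KERNEL OF THE WITNESS DATUM** is supported at the single point `zs`, with the value `½ · c · K Q 0 (inl κ) (inr κ)`
(`K := KInvStep Lc j`): zero first-order vertex ⟹ no bubble; the tadpole reads one entry. [folklore] -/
theorem TstepOf_jetW (j : ℕ) (Q zs : Fin (d + 1) → ℤ) (κ : Fin (d + 1)) (c : ℝ) (μ ν : Fin (d + 1)) (z : Fin (d + 1) → ℤ) :
    TstepOf Lc j (jetW Lc Q zs κ c) μ ν z
      = if z = zs then 1 / 2 * (c * KInvStep (d := d) Lc j Q 0 (Sum.inl κ) (Sum.inr κ)) else 0 := by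
  simp only [TstepOf, jetW, vertexOfK_zeroStencil, hessKer, bubble_zero, mul_zero, sub_zero, unitW, true_and]
  split_ifs with h
  · rw [tadpole_smul_unitKer]
  · rw [tadpole_zero, mul_zero]

/-- **THE (μ,ν) SECOND MOMENT OF THE WITNESS STEP KERNEL** with support point `z⋆ = e_μ + e_ν`:
`½ · c · K Q 0 (inl κ) (inr κ) · z⋆_μ z⋆_ν`. [folklore] -/
theorem secondMoment_TstepOf_jetW (j : ℕ) (Q : Fin (d + 1) → ℤ) (κ : Fin (d + 1)) (c : ℝ) (μ ν : Fin (d + 1)) :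
    secondMoment (TstepOf Lc j (jetW Lc Q (zstar μ ν) κ c)) μ ν
      = 1 / 2 * (c * KInvStep (d := d) Lc j Q 0 (Sum.inl κ) (Sum.inr κ)) * ((zstar μ ν μ : ℤ) : ℝ) * ((zstar μ ν ν : ℤ) : ℝ) := by
  simp only [secondMoment, TstepOf_jetW]
  rw [tsum_eq_single (zstar μ ν)]
  · rw [if_pos rfl]
  · intro z hz
    simp only [hz, if_false, zero_mul]

/-- **PRESCRIBED MOMENTS** (general dimension): for every target sequence `t` and channel `(μ, ν)` there are step jet data whose
typed step-`j` kernels `TstepOf Lc j (Js j)` have `(μ, ν)` second moment EXACTLY `t j` — scale the matrix unit at a non-zero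
`ℋ`-entry of `KInvStep Lc j` (§2). [folklore] -/
theorem exists_jetData_secondMoment_TstepOf_eq (t : ℕ → ℝ) (μ ν : Fin (d + 1)) :
    ∃ Js : ℕ → JetData d Lc, ∀ j, secondMoment (TstepOf Lc j (Js j)) μ ν = t j := by
  classical
  have hex := fun j => exists_KInvStep_ne_zero (d := d) (Lc := Lc) j μ
  choose Q hQ using hex
  obtain ⟨hμ, hν⟩ := zstar_cast_ne_zero (d := d) μ ν
  refine ⟨fun j => jetW Lc (Q j) (zstar μ ν) μ
    (2 * t j / (KInvStep (d := d) Lc j (Q j) 0 (Sum.inl μ) (Sum.inr μ) * (((zstar μ ν μ : ℤ) : ℝ) * ((zstar μ ν ν : ℤ) : ℝ)))),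
    fun j => ?_⟩
  rw [secondMoment_TstepOf_jetW]
  have hE := hQ j
  field_simp

/-- **PRESCRIBED MOMENTS IN DIMENSION FOUR** for the one-step family `TbalOf`: every real sequence is the sequence of `(μ, ν)`
second moments of the typed step kernels of SOME step jet data. [folklore] -/
theorem exists_jetData_secondMoment_eq (t : ℕ → ℝ) (μ ν : Fin 4) :
    ∃ Js : ℕ → JetData 3 Lc, ∀ j, secondMoment (TbalOf Lc Js j) μ ν = t j :=
  exists_jetData_secondMoment_TstepOf_eq (d := 3) t μ ν

/-- **`D1Drift` IS INHABITED** (beta-ref A-R394; the (D1)-side twin of the (R21) vacuity check): for every block size `Lc`, colour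
parameter `N` and channel `(μ, ν)` there are step jet data with `D1Drift Lc Js N μ ν` — moments prescribed EQUAL to the slope
`stepBal N Lc`, cumulative defect `A = 0`.  Says nothing about Bałaban's stencils. [folklore] -/
theorem d1Drift_inhabited (N : ℝ) (μ ν : Fin 4) : ∃ Js : ℕ → JetData 3 Lc, D1Drift Lc Js N μ ν := by
  obtain ⟨Js, hJs⟩ := exists_jetData_secondMoment_eq (Lc := Lc) (fun _ => B12Normalization.stepBal N Lc) μ ν
  refine ⟨Js, 0, fun k => ?_⟩
  simp only [hJs, Finset.sum_const, Finset.card_range, nsmul_eq_mul]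
  rw [mul_comm, sub_self, abs_zero]

/-- **`D1Drift` IS REFUTABLE OVER JET DATA** whenever the slope is non-zero (`N ≠ 0`, `Lc ≥ 2`): the jet data with ALL `(μ, ν)`
moments zero violate it.  Together with `d1Drift_inhabited`: `D1Drift` is neither vacuous nor absurd — its truth is a property
of WHICH jet data, i.e. of Bałaban's stencils (EXIT-A). [folklore] -/
theorem exists_jetData_not_d1Drift {N : ℝ} (hb : B12Normalization.stepBal N Lc ≠ 0) (μ ν : Fin 4) :
    ∃ Js : ℕ → JetData 3 Lc, ¬ D1Drift Lc Js N μ ν := by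
  obtain ⟨Js, hJs⟩ := exists_jetData_secondMoment_eq (Lc := Lc) (fun _ => (0 : ℝ)) μ ν
  refine ⟨Js, ?_⟩
  rintro ⟨A, hA⟩
  -- at `k` the defect is `|stepBal| · k`, unbounded
  obtain ⟨k, hk⟩ := exists_nat_gt (A / |B12Normalization.stepBal N Lc|)
  have hAk := hA k
  simp only [hJs, Finset.sum_const_zero, zero_sub, abs_neg, abs_mul, Nat.abs_cast] at hAk
  have hpos : 0 < |B12Normalization.stepBal N Lc| := abs_pos.2 hb
  rw [div_lt_iff₀ hpos] at hk
  linarith [mul_comm (k : ℝ) |B12Normalization.stepBal N Lc|]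

/-- **NON-DEGENERACY OF THE TYPED READ-OUT**: there are step jet data all of whose typed step kernels have NON-ZERO `(μ, ν)`
second moment (value `1`). [folklore] -/
theorem exists_jetData_secondMoment_ne_zero (μ ν : Fin 4) :
    ∃ Js : ℕ → JetData 3 Lc, ∀ j, secondMoment (TbalOf Lc Js j) μ ν ≠ 0 := by
  obtain ⟨Js, hJs⟩ := exists_jetData_secondMoment_eq (Lc := Lc) (fun _ => (1 : ℝ)) μ ν
  exact ⟨Js, fun j => by rw [hJs]; exact one_ne_zero⟩

/-- **`D1Drift` IS A GENUINE CONDITION ON THE JET DATA** (both halves together). [folklore] -/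
theorem d1Drift_genuine {N : ℝ} (hb : B12Normalization.stepBal N Lc ≠ 0) (μ ν : Fin 4) :
    (∃ Js : ℕ → JetData 3 Lc, D1Drift Lc Js N μ ν) ∧ ∃ Js : ℕ → JetData 3 Lc, ¬ D1Drift Lc Js N μ ν :=
  ⟨d1Drift_inhabited N μ ν, exists_jetData_not_d1Drift hb μ ν⟩

/-- The advisory's literal form (A-R394): `∃ Js N μ ν, N ≠ 0 ∧ D1Drift Lc Js N μ ν`, here with an off-diagonal channel. [folklore] -/
theorem exists_d1Drift_N_ne_zero :
    ∃ (Js : ℕ → JetData 3 Lc) (N : ℝ) (μ ν : Fin 4), N ≠ 0 ∧ μ ≠ ν ∧ D1Drift Lc Js N μ ν := by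
  obtain ⟨Js, hJs⟩ := d1Drift_inhabited (Lc := Lc) 1 0 1
  exact ⟨Js, 1, 0, 1, one_ne_zero, Fin.zero_ne_one, hJs⟩

end Witness

/-! ## §5 (v1.1) `D1Rep ⟺ D1Drift` BY NAME AT THE TYPED OBJECTS — RULING (R24) as a kernel iff (beta-ref v54 R419 (b))

an2's `OneStepKernelFamily` v1.2 §10 proves `d1Drift_of_D1Tel_D1Rep` (proof route ⟹ statement).  RULING (R24) reads the converse off the
lead's `ScalewiseVectorSeam.d1Rep_iff_oneLoopDrift` (v1.6 §9): GIVEN the route data, the representation binder `D1Rep` (the composite one-shot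
second moment stays within a scale-uniform constant of the free reference bubble) holds IFF the step coefficients drift, `D1Drift`.  The referee
(v54 R419 (b)) asked for that iff BY NAME at the typed objects `TbalOf`/`TshotOf`; here it is.  Consequence for the census: row (D1) is ONE
statement, `D1Drift Lc (JsBal N Lc) N μ ν` once (i′) names `JsBal`; `D1Rep` is its proof-route form, not a second leg.  Nothing is proved for
Bałaban's jets; [folklore]; NOT `BetaPertH`, NOT continuum, NOT Clay. -/

section IffByName

open Literature.MathematicalPhysics.QuantumFieldTheory.Balaban1983to89.Beta.OneStepKernelFamily (TshotOf D1Tel D1Rep flipK hdec_TbalOf)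
open Literature.MathematicalPhysics.QuantumFieldTheory.Balaban1983to89.Beta.VectorTailsLoc (fam kfam)
open Literature.MathematicalPhysics.QuantumFieldTheory.Balaban1983to89.Beta.VectorLegVolumeAdapter (MvE)
open Literature.MathematicalPhysics.QuantumFieldTheory.Balaban1983to89.Beta.PolarizationSign (WardTransversal AxisReflectionCovariant)

variable {Lc : ℕ} [NeZero Lc] {L : Type*}

/-- **`D1Rep ⟺ D1Drift` AT THE TYPED OBJECTS** (RULING (R24), beta-ref v54 R419 (b)).  Under the route data of an2's `d1Drift_of_D1Tel_D1Rep`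
— the two printed Props BY NAME (h12, h126), base-point labels, `μ ≠ ν`, `N ≠ 0`, `2 ≤ Lc`, the printed Ward identity (5.9) and reflection
covariance (5.7) asked of the FLIPPED typed step kernels `flipK (TbalOf Lc Js j)` (RULING (R21)), `D1Tel Lc Js Jc`, and the window data — the
representation binder `D1Rep Lc Jc N μ ν a SL k` holds IFF `D1Drift Lc Js N μ ν`.  (`hTA`/(T0)/(T1) from `hdec_TbalOf` + hW + hR via
`ScalewiseVectorSeam.scalewiseData_of_printed_flip`; then `ScalewiseVectorSeam.d1Rep_iff_oneLoopDrift` at `T := TbalOf Lc Js`, `𝒯 := TshotOf Lc Jc`,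
`Sβ := splitOf (fun j => secondMoment (TbalOf Lc Js j) μ ν)`, `hβ := fun _ => rfl`.)  Both sides are hypotheses about jet data; NEITHER is proved
for Bałaban's stencils here. [folklore] -/
theorem d1Rep_iff_d1Drift (a : ℝ) (ha : 0 < a)
    (h12 : B5.Prop12Printed (fam (fun i : ℕ+ × ℕ => ((i.1 : ℕ+) : ℕ)) (fun i => i.1.pos) MvE a ha))
    (h126 : B5.Kernel126_127Printed (kfam (fun i : ℕ+ × ℕ => ((i.1 : ℕ+) : ℕ)) MvE))
    {SL : Finset L} (hSL : SL.Nonempty) (k : L → Fin 4) {μ ν : Fin 4} (hμν : μ ≠ ν) {N : ℝ} (hN : N ≠ 0) (hL : 2 ≤ Lc)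
    (Js : ℕ → JetData 3 Lc) (Jc : ∀ m : ℕ, JetData 3 (Lc ^ m))
    (hW : ∀ j, WardTransversal (flipK (TbalOf Lc Js j))) (hR : ∀ j, AxisReflectionCovariant (flipK (TbalOf Lc Js j)))
    (htel : D1Tel Lc Js Jc)
    {cc : ℝ} {M : ℕ → ℕ} (hc : 1 ≤ cc) (hM : ∀ L : ℕ, 2 ≤ L → 1 ≤ M L ∧ (L : ℝ) ≤ cc * M L) (hML : ∀ L : ℕ, 2 ≤ L → M L ≤ L) :
    D1Rep Lc Jc N μ ν a SL k ↔ D1Drift Lc Js N μ ν := by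
  obtain ⟨hTA, hT0, hT1⟩ := ScalewiseVectorSeam.scalewiseData_of_printed_flip (hdec_TbalOf Js) hW hR
  exact ScalewiseVectorSeam.d1Rep_iff_oneLoopDrift a ha h12 h126 hSL k
    (ScalewiseVectorSeam.splitOf fun j => secondMoment (TbalOf Lc Js j) μ ν) hμν hN hL (TbalOf Lc Js) (TshotOf Lc Jc)
    hTA hT0 hT1 (fun _ => rfl) htel hc hM hML

/-- **THE CONVERSE OF an2's `d1Drift_of_D1Tel_D1Rep`, BY NAME**: under the same route data, the drift of the typed step coefficients GIVES the
representation binder for ANY composite jet data `Jc` telescoping onto them (`D1Tel Lc Js Jc`) — the free reference bubble drifts with the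
same slope (`ScalewiseVectorSeam.oneShotSide_drift`), so the difference stays bounded.  [folklore] -/
theorem d1Rep_of_d1Drift (a : ℝ) (ha : 0 < a)
    (h12 : B5.Prop12Printed (fam (fun i : ℕ+ × ℕ => ((i.1 : ℕ+) : ℕ)) (fun i => i.1.pos) MvE a ha))
    (h126 : B5.Kernel126_127Printed (kfam (fun i : ℕ+ × ℕ => ((i.1 : ℕ+) : ℕ)) MvE))
    {SL : Finset L} (hSL : SL.Nonempty) (k : L → Fin 4) {μ ν : Fin 4} (hμν : μ ≠ ν) {N : ℝ} (hN : N ≠ 0) (hL : 2 ≤ Lc)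
    (Js : ℕ → JetData 3 Lc) (Jc : ∀ m : ℕ, JetData 3 (Lc ^ m))
    (hW : ∀ j, WardTransversal (flipK (TbalOf Lc Js j))) (hR : ∀ j, AxisReflectionCovariant (flipK (TbalOf Lc Js j)))
    (htel : D1Tel Lc Js Jc)
    {cc : ℝ} {M : ℕ → ℕ} (hc : 1 ≤ cc) (hM : ∀ L : ℕ, 2 ≤ L → 1 ≤ M L ∧ (L : ℝ) ≤ cc * M L) (hML : ∀ L : ℕ, 2 ≤ L → M L ≤ L)
    (hD : D1Drift Lc Js N μ ν) : D1Rep Lc Jc N μ ν a SL k :=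
  (d1Rep_iff_d1Drift a ha h12 h126 hSL k hμν hN hL Js Jc hW hR htel hc hM hML).2 hD

end IffByName

/-! ## §6 (v1.2) THE UNITS PIN — `R̂_j = Lc^{d+1} • wStep` (RULING (R25-1)(ii); beta-ref A-R428, v57 R433 (iii))

beta-an4's FINDING X-an4-37 and beta-an2's ANSWER (A2) fixed the normalisation of the step-`j` response in two places: on the JETS side the
composite jet recursion transports through the bond-unit response `R̂_j := Lc^((d+2)·j+(d+1)) • colH (KInvStep Lc j) Lc` («`Lc`-coset mass
`σ = Lc^{−1}`, `j`-independent»), on the KERNEL side `HessianTelescopingKKT.StepRecursion` transports the one-shot Hessian kernel through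
`wStep Lc j c a p := Lc^{5j} · KInvStep Lc j (−p) 0 (inl c) (inr a)` (mass `Lc^{−5}`) with the bond-unit prefactor `Lc^8`.  The referee (A-R428,
R433 (iii)) asked that the factor `Lc^{d+1} = Lc^4` between them be PINNED by a kernel lemma so that (R1) is read under ONE convention.  This
section is that pin, at `d = 3`: the two are one response (`respBond_eq_wStep`, by the block covariance of `KInvStep`), their masses are `Lc^{−1}`
and `Lc^{−5}` (`constReproSum_respBond` / `HessianTelescopingKKT.constReproSum_wStep`), and the prefactor `Lc^8` of `StepRecursion` is exactly
one `Lc^4` per response leg (`stepRecursion_wStep_iff`).  CONVENTION, stated once: (R1) is `StepRecursion Lc (TbalOf Lc Js) (TshotOf Lc Jc) (wStep Lc)`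
(consumed by `d1Tel_of_stepRecursion_wStep`); `R̂_j = respBond Lc j` is available BY NAME for the jets side.  Bookkeeping only; [folklore];
nothing of Bałaban's is asserted; NOT `BetaPertH`, NOT continuum, NOT Clay. -/

section UnitsPin

open Literature.MathematicalPhysics.QuantumFieldTheory.Balaban1983to89.Beta.HessianTelescopingKKT (stepCol wStep StepRecursion
  constReproSum_wStep constReproSum_const_mul)
open Literature.MathematicalPhysics.QuantumFieldTheory.Balaban1983to89.Beta.OneStepKernelFamily (shiftK_KInvStep)
open Literature.MathematicalPhysics.QuantumFieldTheory.Balaban1983to89.Beta.DressedMomentNormalisation (dressedEntry)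
open Literature.MathematicalPhysics.QuantumFieldTheory.Balaban1983to89.Beta.DecimatedMomentSummable (dressedSum ConstReproSum)
open Literature.MathematicalPhysics.QuantumFieldTheory.Balaban1983to89.Beta.DecimatedMoment (cosetInd cosetInd_neg)
open Literature.MathematicalPhysics.QuantumFieldTheory.Balaban1983to89.Beta.ExpKernelCalculus (shiftK)

variable {Lc : ℕ} [NeZero Lc]

/-- Block covariance of the decimated composite resolvent read at the coarse origin: `KInvStep Lc j u (Lc•y) = KInvStep Lc j (u − Lc•y) 0`
(`OneStepKernelFamily.shiftK_KInvStep`). [folklore] -/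
theorem KInvStep_coarse_eq_sub (j : ℕ) (u y : Fin (d + 1) → ℤ) (p q : Fib d) :
    KInvStep (d := d) Lc j u ((Lc : ℤ) • y) p q = KInvStep (d := d) Lc j (u - (Lc : ℤ) • y) 0 p q := by
  have h := congrFun (congrFun (congrFun (congrFun (shiftK_KInvStep (d := d) (Lc := Lc) j y) u) ((Lc : ℤ) • y)) p) q
  simp only [shiftK, add_neg_cancel, ← sub_eq_add_neg] at h
  exact h.symm

/-- **THE BOND-UNIT STEP RESPONSE `R̂_j` OF RULING (R25-1)(ii)** (beta-an2 ANSWER (A2), literally, at `d = 3`, so `(d+2)·j+(d+1) = 5j+4`):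
`respBond Lc j a y c u := Lc^(5j+4) · colH (KInvStep Lc j) Lc a y c u = Lc^(5j+4) · KInvStep Lc j u (Lc•y) (inl c) (inr a)` — the response of the fine
field of type `c` at `u` to the coarse bond variable of type `a` at `y`, in the argument order of the response slot of `InterLevelTransport.transportV`.
[folklore] -/
noncomputable def respBond (Lc : ℕ) [NeZero Lc] (j : ℕ) (a : Fin 4) (y : Fin 4 → ℤ) (c : Fin 4) (u : Fin 4 → ℤ) : ℝ :=
  (Lc : ℝ) ^ (5 * j + 4) * colH (KInvStep (d := 3) Lc j) Lc a y c u

/-- **THE PIN**: `R̂_j a y c u = Lc^4 · wStep Lc j c a (Lc•y − u)` — ONE response in two spellings (the factor `Lc^{d+1} = Lc^4` and the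
reflected-translated argument; block covariance of `KInvStep`). [folklore] -/
theorem respBond_eq_wStep (j : ℕ) (a : Fin 4) (y : Fin 4 → ℤ) (c : Fin 4) (u : Fin 4 → ℤ) :
    respBond Lc j a y c u = (Lc : ℝ) ^ 4 * wStep Lc j c a ((Lc : ℤ) • y - u) := by
  simp only [respBond, wStep, stepCol, colH]
  rw [neg_sub, KInvStep_coarse_eq_sub (d := 3), pow_add]
  ring

/-- The converse spelling: `wStep Lc j c a p = Lc^{−4} · R̂_j a 0 c (−p)`. [folklore] -/
theorem wStep_eq_respBond (j : ℕ) (c a : Fin 4) (p : Fin 4 → ℤ) :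
    wStep Lc j c a p = ((Lc : ℝ) ^ 4)⁻¹ * respBond Lc j a 0 c (-p) := by
  have hL : (Lc : ℝ) ^ 4 ≠ 0 := pow_ne_zero _ (by exact_mod_cast (NeZero.ne Lc))
  rw [respBond_eq_wStep, smul_zero, zero_sub, neg_neg, ← mul_assoc, inv_mul_cancel₀ hL, one_mul]

/-- Constant reproduction through `N•ℤ^d` is insensitive to the reflection `u ↦ −u` of the pattern (same mass). [folklore] -/
theorem constReproSum_reflect {N : ℕ} {f : (Fin d → ℤ) → ℝ} {σ : ℝ} (h : ConstReproSum N f σ) :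
    ConstReproSum N (fun u => f (-u)) σ := by
  intro a
  have e : (fun u : Fin d → ℤ => cosetInd N (a - u) • f (-u))
      = (fun u : Fin d → ℤ => cosetInd N (-a - u) • f u) ∘ (Equiv.neg (Fin d → ℤ)) := by
    funext u
    simp only [Function.comp_apply, Equiv.neg_apply]
    rw [← cosetInd_neg N (a - u)]
    congr 2
    abel
  rw [e]
  exact (Equiv.neg (Fin d → ℤ)).hasSum_iff.2 (h (-a))

/-- **THE MASS OF `R̂_j`**: the `Lc`-coset Kronecker mass of `u ↦ R̂_j a 0 c u` is `δ_{ca} · Lc^{−1}` at EVERY `j` — beta-an2 (A2)'s «`σ = Lc^{−1}`,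
`j`-independent» — versus `δ · Lc^{−5}` for `wStep` (`HessianTelescopingKKT.constReproSum_wStep`): the two normalisations differ by exactly
`Lc^{d+1} = Lc^4`. [folklore] -/
theorem constReproSum_respBond (j : ℕ) (a c : Fin 4) :
    ConstReproSum Lc (fun u => respBond Lc j a 0 c u) (if c = a then ((Lc : ℝ))⁻¹ else 0) := by
  have hL : (Lc : ℝ) ≠ 0 := by exact_mod_cast (NeZero.ne Lc)
  have h := constReproSum_reflect (constReproSum_const_mul (constReproSum_wStep (Lc := Lc) j c a) ((Lc : ℝ) ^ 4))
  have ev : (Lc : ℝ) ^ 4 * (if c = a then (((Lc : ℝ) ^ (4 + 1))⁻¹) else 0) = (if c = a then ((Lc : ℝ))⁻¹ else 0) := by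
    split_ifs
    · rw [pow_succ (Lc : ℝ) 4, mul_inv, ← mul_assoc, mul_inv_cancel₀ (pow_ne_zero _ hL), one_mul]
    · rw [mul_zero]
  rw [ev] at h
  refine fun a₀ => (h a₀).congr_fun fun u => ?_
  simp only [respBond_eq_wStep, smul_zero, zero_sub]

/-- **THE TWO-LEG TRANSPORT IS QUADRATIC IN THE WEIGHT**: scaling the response weight by `r` scales `DressedMomentNormalisation.dressedEntry` by
`r²` (one factor per leg). [folklore] -/
theorem dressedEntry_const_mul {n : ℕ} (r : ℝ) (w T : EKer n) (y : Fin n → ℤ) (a b : Fin n) :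
    dressedEntry (fun κ l p => r * w κ l p) T y a b = r ^ 2 * dressedEntry w T y a b := by
  unfold dressedEntry dressedSum
  rw [Finset.mul_sum]
  refine Finset.sum_congr rfl fun c _ => ?_
  rw [Finset.mul_sum]
  refine Finset.sum_congr rfl fun e _ => ?_
  rw [← tsum_mul_left]
  refine tsum_congr fun q => ?_
  ring

/-- **THE BOND-UNIT WEIGHT** `bondW Lc j := Lc^4 • wStep Lc j` — `R̂_j` read as an entry kernel (`bondW_eq_respBond`). [folklore] -/
noncomputable def bondW (Lc : ℕ) [NeZero Lc] (j : ℕ) : EKer 4 := fun κ l p => (Lc : ℝ) ^ 4 * wStep Lc j κ l p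

/-- `bondW Lc j c a p = R̂_j a 0 c (−p)`. [folklore] -/
theorem bondW_eq_respBond (j : ℕ) (c a : Fin 4) (p : Fin 4 → ℤ) : bondW Lc j c a p = respBond Lc j a 0 c (-p) := by
  simp only [bondW, respBond_eq_wStep, smul_zero, zero_sub, neg_neg]

/-- The `Lc`-coset Kronecker mass of `bondW Lc j κ l` is `δ_{κl} · Lc^{−1}` at every `j`. [folklore] -/
theorem constReproSum_bondW (j : ℕ) (κ l : Fin 4) :
    ConstReproSum Lc (bondW Lc j κ l) (if κ = l then ((Lc : ℝ))⁻¹ else 0) := by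
  have hL : (Lc : ℝ) ≠ 0 := by exact_mod_cast (NeZero.ne Lc)
  have h := constReproSum_const_mul (constReproSum_wStep (Lc := Lc) j κ l) ((Lc : ℝ) ^ 4)
  have ev : (Lc : ℝ) ^ 4 * (if κ = l then (((Lc : ℝ) ^ (4 + 1))⁻¹) else 0) = (if κ = l then ((Lc : ℝ))⁻¹ else 0) := by
    split_ifs
    · rw [pow_succ (Lc : ℝ) 4, mul_inv, ← mul_assoc, mul_inv_cancel₀ (pow_ne_zero _ hL), one_mul]
    · rw [mul_zero]
  rw [ev] at h
  exact h

/-- **`StepRecursion … (wStep Lc)` IS THE PREFACTOR-FREE TWO-LEG TRANSPORT WITH `R̂`-NORMALISED LEGS**: the bond-unit prefactor `Lc^8 = Lc^{2·4}` of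
`HessianTelescopingKKT.StepRecursion` is exactly one factor `Lc^{d+1} = Lc^4` on each of the two response legs of `dressedEntry`.  So the (R1) of
P6 — `StepRecursion Lc (TbalOf Lc Js) (TshotOf Lc Jc) (wStep Lc)`, the binder of `HessianTelescopingKKT.d1Tel_of_stepRecursion_wStep` — and the jets-side
transport through `R̂_j` are ONE convention. [folklore] -/
theorem stepRecursion_wStep_iff (T 𝒯 : ℕ → EKer 4) :
    StepRecursion Lc T 𝒯 (wStep Lc) ↔
      ∀ j : ℕ, 1 ≤ j → ∀ (a b : Fin 4) (z : Fin 4 → ℤ),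
        𝒯 (j + 1) a b z = dressedEntry (bondW Lc j) (𝒯 j) ((Lc : ℤ) • z) a b + T j a b z := by
  have key : ∀ (j : ℕ) (a b : Fin 4) (z : Fin 4 → ℤ),
      (Lc : ℝ) ^ 8 * dressedEntry (wStep Lc j) (𝒯 j) ((Lc : ℤ) • z) a b = dressedEntry (bondW Lc j) (𝒯 j) ((Lc : ℤ) • z) a b := by
    intro j a b z
    rw [show bondW Lc j = fun κ l p => (Lc : ℝ) ^ 4 * wStep Lc j κ l p from rfl, dressedEntry_const_mul]
    ring
  unfold StepRecursion
  refine forall₂_congr fun j _ => forall₃_congr fun a b z => ?_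
  rw [key]

end UnitsPin

/-! ## §7 (v1.3) THE JET-LEVEL READ-OUT TELESCOPING `D1Sum` — (D1-tel) CUT AT THE READ-OUT LEVEL (lead seam decision on X-an4-38)

beta-an4-g16 observed (X-an4-38) that EXIT-B consumes `htel : D1Tel Lc Js Jc` only through ONE additive read-out of the second-moment tensors
(`HidentScalewise.flowSum_eq_oneShotReadout` at `readout122 μ ν`), and RULING (R26-2) made the inter-slice longitudinal cancellation (P6c) a typed
support item whose weakest sufficient level is that read-out.  `ScalewiseVectorSeam` v1.8 §11 cut the abstract seam there (`ReadoutSum`,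
`readoutRep_iff_oneLoopDrift`: NO step-kernel data in the socket).  Here is the jet-level twin BY NAME at the typed objects: the predicate `D1Sum`, the
fact that the v1 route (`D1Tel` + Ward/reflection data) implies it, and the iff `D1Rep ⟺ D1Drift` GIVEN `D1Sum` — without hW/hR and without `D1Tel`.
Nothing is proved for Bałaban's jets; [folklore]; NOT `BetaPertH`, NOT continuum, NOT Clay. -/

section ReadoutByName

open Literature.MathematicalPhysics.QuantumFieldTheory.Balaban1983to89.Beta.OneStepKernelFamily (TshotOf D1Tel D1Rep flipK hdec_TbalOf)
open Literature.MathematicalPhysics.QuantumFieldTheory.Balaban1983to89.Beta.VectorTailsLoc (fam kfam)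
open Literature.MathematicalPhysics.QuantumFieldTheory.Balaban1983to89.Beta.VectorLegVolumeAdapter (MvE)
open Literature.MathematicalPhysics.QuantumFieldTheory.Balaban1983to89.Beta.PolarizationSign (WardTransversal AxisReflectionCovariant)
open Literature.MathematicalPhysics.QuantumFieldTheory.Balaban1983to89.Beta.ScalewiseVectorSeam (ReadoutSum readoutSum_of_hessianTelescoping
  readoutRep_iff_oneLoopDrift splitOf scalewiseData_of_printed_flip)

variable {Lc : ℕ} [NeZero Lc] {L : Type*}

/-- **EXIT-B PREDICATE (D1-sum) OVER JET DATA — READ-OUT-LEVEL TELESCOPING**: for every `m ≥ 1` the partial sum of the step coefficients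
`β⁰_j := secondMoment (TbalOf Lc Js j) μ ν` IS the (1.22) read-out `secondMoment (TshotOf Lc Jc m) μ ν` of the one-shot kernel of the `m`-step composite system.
The weakest telescoping binder the wall consumes; a predicate over the jet parameters, never a fact. [folklore] -/
def D1Sum (Lc : ℕ) [NeZero Lc] (Js : ℕ → JetData 3 Lc) (Jc : ∀ m : ℕ, JetData 3 (Lc ^ m)) (μ ν : Fin 4) : Prop :=
  ReadoutSum (fun j => secondMoment (TbalOf Lc Js j) μ ν) (TshotOf Lc Jc) μ ν

/-- Unfolding. [folklore] -/
theorem d1Sum_iff (Js : ℕ → JetData 3 Lc) (Jc : ∀ m : ℕ, JetData 3 (Lc ^ m)) (μ ν : Fin 4) :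
    D1Sum Lc Js Jc μ ν ↔
      ∀ m : ℕ, 1 ≤ m → ∑ j ∈ range m, secondMoment (TbalOf Lc Js j) μ ν = secondMoment (TshotOf Lc Jc m) μ ν :=
  Iff.rfl

/-- **THE v1 ROUTE IMPLIES THE READ-OUT-LEVEL BINDER**: `D1Tel Lc Js Jc` + the printed Ward identity and reflection covariance asked of the flipped typed
step kernels (for (T0)/(T1), via `ScalewiseVectorSeam.scalewiseData_of_printed_flip` and `hdec_TbalOf`) ⟹ `D1Sum Lc Js Jc μ ν`. [folklore] -/
theorem d1Sum_of_d1Tel (Js : ℕ → JetData 3 Lc) (Jc : ∀ m : ℕ, JetData 3 (Lc ^ m))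
    (hW : ∀ j, WardTransversal (flipK (TbalOf Lc Js j))) (hR : ∀ j, AxisReflectionCovariant (flipK (TbalOf Lc Js j)))
    (htel : D1Tel Lc Js Jc) (μ ν : Fin 4) : D1Sum Lc Js Jc μ ν := by
  obtain ⟨hTA, hT0, hT1⟩ := scalewiseData_of_printed_flip (hdec_TbalOf Js) hW hR
  exact readoutSum_of_hessianTelescoping hTA hT0 hT1 (fun _ => rfl) htel

/-- **`D1Rep ⟺ D1Drift` GIVEN `D1Sum`** — the iff of §5 with the telescoping binder cut at the read-out level: the two printed Props BY NAME (h12, h126),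
base-point labels, `μ ≠ ν`, `N ≠ 0`, `2 ≤ Lc`, the window data and `D1Sum Lc Js Jc μ ν`; NO Ward/reflection data and NO `D1Tel`.
(`ScalewiseVectorSeam.readoutRep_iff_oneLoopDrift` at `𝒯 := TshotOf Lc Jc`, `Sβ := splitOf (fun j => secondMoment (TbalOf Lc Js j) μ ν)`.) [folklore] -/
theorem d1Rep_iff_d1Drift_of_d1Sum (a : ℝ) (ha : 0 < a)
    (h12 : B5.Prop12Printed (fam (fun i : ℕ+ × ℕ => ((i.1 : ℕ+) : ℕ)) (fun i => i.1.pos) MvE a ha))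
    (h126 : B5.Kernel126_127Printed (kfam (fun i : ℕ+ × ℕ => ((i.1 : ℕ+) : ℕ)) MvE))
    {SL : Finset L} (hSL : SL.Nonempty) (k : L → Fin 4) {μ ν : Fin 4} (hμν : μ ≠ ν) {N : ℝ} (hN : N ≠ 0) (hL : 2 ≤ Lc)
    (Js : ℕ → JetData 3 Lc) (Jc : ∀ m : ℕ, JetData 3 (Lc ^ m)) (hsum : D1Sum Lc Js Jc μ ν)
    {cc : ℝ} {M : ℕ → ℕ} (hc : 1 ≤ cc) (hM : ∀ L : ℕ, 2 ≤ L → 1 ≤ M L ∧ (L : ℝ) ≤ cc * M L) (hML : ∀ L : ℕ, 2 ≤ L → M L ≤ L) :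
    D1Rep Lc Jc N μ ν a SL k ↔ D1Drift Lc Js N μ ν :=
  readoutRep_iff_oneLoopDrift a ha h12 h126 hSL k (splitOf fun j => secondMoment (TbalOf Lc Js j) μ ν) hμν hN hL (TshotOf Lc Jc)
    hsum hc hM hML

/-- **THE ROUTE'S IMPLICATION AT THE READ-OUT LEVEL**: `D1Sum` + `D1Rep` (+ the standing data) ⟹ `D1Drift` — an2's `d1Drift_of_D1Tel_D1Rep` with the
telescoping binder weakened to the read-out level and the Ward/reflection binders gone from the seam. [folklore] -/
theorem d1Drift_of_d1Sum_D1Rep (a : ℝ) (ha : 0 < a)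
    (h12 : B5.Prop12Printed (fam (fun i : ℕ+ × ℕ => ((i.1 : ℕ+) : ℕ)) (fun i => i.1.pos) MvE a ha))
    (h126 : B5.Kernel126_127Printed (kfam (fun i : ℕ+ × ℕ => ((i.1 : ℕ+) : ℕ)) MvE))
    {SL : Finset L} (hSL : SL.Nonempty) (k : L → Fin 4) {μ ν : Fin 4} (hμν : μ ≠ ν) {N : ℝ} (hN : N ≠ 0) (hL : 2 ≤ Lc)
    (Js : ℕ → JetData 3 Lc) (Jc : ∀ m : ℕ, JetData 3 (Lc ^ m)) (hsum : D1Sum Lc Js Jc μ ν)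
    {cc : ℝ} {M : ℕ → ℕ} (hc : 1 ≤ cc) (hM : ∀ L : ℕ, 2 ≤ L → 1 ≤ M L ∧ (L : ℝ) ≤ cc * M L) (hML : ∀ L : ℕ, 2 ≤ L → M L ≤ L)
    (hrep : D1Rep Lc Jc N μ ν a SL k) : D1Drift Lc Js N μ ν :=
  (d1Rep_iff_d1Drift_of_d1Sum a ha h12 h126 hSL k hμν hN hL Js Jc hsum hc hM hML).1 hrep

end ReadoutByName

/-! ## §8 (v1.4) RULING (R28-1) IN KERNEL — AT THE READ-OUT LEVEL P6 IS ONE CLOSED PREDICATE OVER (Js, Jc): THE FULL STEP DEFECT `SD`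
AND ITS (μ, ν)-INVISIBILITY `SDInvisible`

beta-an4's `HessianTelescopingKKT` v1.3/v1.4 states the one-step transport recursion MODULO an abstract correction family `R` and proves the
read-out-level socket `secondMomentSum_of_stepRecursionUpTo_wStep`; with `R :=` the FULL step defect `stepDefect Lc T 𝒯 (wStep Lc)` the recursion
holds for free (`stepRecursionUpTo_stepDefect`).  Specialised to the typed families `TbalOf Lc Js` / `TshotOf Lc Jc` this gives the census reading
of RULING (R28-1): `D1Sum Lc Js Jc μ ν` follows from the Ward data (T0)/(T1) of the step family, the base identity `hbase`, the zeroth/first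
decimated moments and `AbsMoment₂` of the explicit defect `SD Lc Js Jc j` (`j ≥ 1`), and the ONE clause (SDF) `∀ j ≥ 1, secondMoment (SD Lc Js Jc j) μ ν
= 0` — every item a CLOSED predicate over the jet data, with no transport family, no composition identity and no `JcRec`-internal datum in the
statement; (SD0)/(SD1) are themselves consequences of the Ward data of BOTH families (`sd_wardData_of_families`), and GIVEN those data (SDF) is not
only sufficient but EQUIVALENT to `D1Sum` (`d1Sum_iff_sdInvisible`).  The cell's split of (SDF) into composition algebra (`K1b'`/`K1cNeg`/`K1aTrans`/
`JcRec`) + P6c «LongitudinalCancellation» is the PROOF ROUTE of (SDF) for Bałaban's jets (RULING (R28-2)); nothing of it is used or asserted here.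
Bookkeeping over an4's socket; [folklore]; discharges NOTHING of the wall; NOT `BetaPertH`, NOT continuum, NOT Clay. -/

section StepDefectPin

open Literature.MathematicalPhysics.QuantumFieldTheory.Balaban1983to89.Beta.OneStepKernelFamily (TshotOf D1Rep hTA_TbalOf absMoment₂_TshotOf)
open Literature.MathematicalPhysics.QuantumFieldTheory.Balaban1983to89.Beta.HessianTelescopingKKT (stepDefect wStep StepRecursionUpTo
  AdmissibleTransport stepRecursionUpTo_stepDefect secondMomentSum_of_stepRecursionUpTo_wStep m2Tensor_step_of_stepRecursionUpTo
  constReproSum_wStep linReproSum_wStep absMoment₂_wStep hasSum_dressedEntry_zero hasSum_dressedEntry_first)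
open Literature.MathematicalPhysics.QuantumFieldTheory.Balaban1983to89.Beta.DressedMomentNormalisation (dressedEntry EntryHyps m2Tensor)
open Literature.MathematicalPhysics.QuantumFieldTheory.Balaban1983to89.Beta.DecimatedMomentSummable (AbsMoment₂)
open Literature.MathematicalPhysics.QuantumFieldTheory.Balaban1983to89.Beta.ScalewiseVectorSeam (readout122 readout122_add readout122_m2Tensor)
open Literature.MathematicalPhysics.QuantumFieldTheory.Balaban1983to89.Beta.VectorTailsLoc (fam kfam)
open Literature.MathematicalPhysics.QuantumFieldTheory.Balaban1983to89.Beta.VectorLegVolumeAdapter (MvE)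

variable {Lc : ℕ} [NeZero Lc] {L : Type*}

/-- **THE FULL STEP DEFECT OF THE TYPED FAMILIES W.R.T. THE CANONICAL WEIGHT**: `SD Lc Js Jc j a b z := TshotOf Lc Jc (j+1) a b z −
(Lc^8 · dressedEntry (wStep Lc j) (TshotOf Lc Jc j) (Lc•z) a b + TbalOf Lc Js j a b z)` (= `HessianTelescopingKKT.stepDefect` at the typed families;
an explicit `EKer 4`-valued function of the jet data, no parameter).  For Bałaban's data it is the sum of the composition-algebra defect and the
longitudinal remainder of RULING (R26-2); here an abbreviation. [folklore] -/
noncomputable def SD (Lc : ℕ) [NeZero Lc] (Js : ℕ → JetData 3 Lc) (Jc : ∀ m : ℕ, JetData 3 (Lc ^ m)) : ℕ → EKer 4 :=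
  stepDefect Lc (TbalOf Lc Js) (TshotOf Lc Jc) (wStep Lc)

/-- Unfolding of `SD` to an4's `stepDefect`. [folklore] -/
theorem sd_eq_stepDefect (Js : ℕ → JetData 3 Lc) (Jc : ∀ m : ℕ, JetData 3 (Lc ^ m)) :
    SD Lc Js Jc = stepDefect Lc (TbalOf Lc Js) (TshotOf Lc Jc) (wStep Lc) := rfl

/-- Entrywise unfolding of `SD`. [folklore] -/
theorem sd_apply (Js : ℕ → JetData 3 Lc) (Jc : ∀ m : ℕ, JetData 3 (Lc ^ m)) (j : ℕ) (a b : Fin 4) (z : Fin 4 → ℤ) :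
    SD Lc Js Jc j a b z = TshotOf Lc Jc (j + 1) a b z
      - ((Lc : ℝ) ^ 8 * dressedEntry (wStep Lc j) (TshotOf Lc Jc j) ((Lc : ℤ) • z) a b + TbalOf Lc Js j a b z) := rfl

/-- **(SDF) THE READ-OUT-LEVEL INVISIBILITY OF THE STEP DEFECT** in the channel `(μ, ν)`: `∀ j ≥ 1, secondMoment (SD Lc Js Jc j) μ ν = 0`.  RULING (R28-1):
at EXIT-B grade the whole of P6 (layers 1 + 2 + P6c) is this ONE closed clause next to P5′ and `hbase`; a predicate over the jet parameters, never a
fact; for Bałaban's jets its proof (composition algebra + P6c) is EXIT-A content. [folklore] -/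
def SDInvisible (Lc : ℕ) [NeZero Lc] (Js : ℕ → JetData 3 Lc) (Jc : ∀ m : ℕ, JetData 3 (Lc ^ m)) (μ ν : Fin 4) : Prop :=
  ∀ j : ℕ, 1 ≤ j → secondMoment (SD Lc Js Jc j) μ ν = 0

/-- Unfolding. [folklore] -/
theorem sdInvisible_iff (Js : ℕ → JetData 3 Lc) (Jc : ∀ m : ℕ, JetData 3 (Lc ^ m)) (μ ν : Fin 4) :
    SDInvisible Lc Js Jc μ ν ↔ ∀ j : ℕ, 1 ≤ j → secondMoment (SD Lc Js Jc j) μ ν = 0 := Iff.rfl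

/-- **THE RECURSION MODULO THE FULL DEFECT IS FREE** (an4's `stepRecursionUpTo_stepDefect` at the typed families). [folklore] -/
theorem stepRecursionUpTo_sd (Js : ℕ → JetData 3 Lc) (Jc : ∀ m : ℕ, JetData 3 (Lc ^ m)) :
    StepRecursionUpTo Lc (TbalOf Lc Js) (TshotOf Lc Jc) (wStep Lc) (SD Lc Js Jc) :=
  stepRecursionUpTo_stepDefect Lc (TbalOf Lc Js) (TshotOf Lc Jc) (wStep Lc)

/-- **RULING (R28-1) IN KERNEL — `D1Sum` FROM CLOSED PREDICATES OVER THE JET DATA**: (T0)/(T1) of the step family `TbalOf Lc Js`, the base identity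
`hbase`, vanishing zeroth/first decimated moments (SD0)/(SD1) and `AbsMoment₂` (SDA) of the full step defect `SD Lc Js Jc j` (`j ≥ 1`), and (SDF)
`SDInvisible Lc Js Jc μ ν` give `D1Sum Lc Js Jc μ ν` — an4's `secondMomentSum_of_stepRecursionUpTo_wStep` AT `R := SD Lc Js Jc` with the recursion supplied by
`stepRecursionUpTo_sd` (free).  No transport family, no `K1*`, no Ward/reflection predicate on the one-shot family appears. [folklore] -/
theorem d1Sum_of_stepDefect (Js : ℕ → JetData 3 Lc) (Jc : ∀ m : ℕ, JetData 3 (Lc ^ m)) {μ ν : Fin 4}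
    (hT0 : ∀ j (c e : Fin 4), HasSum (TbalOf Lc Js j c e) 0)
    (hT1 : ∀ j (c e ρ : Fin 4), HasSum (fun t : Fin 4 → ℤ => t ρ • TbalOf Lc Js j c e t) 0)
    (hbase : TshotOf Lc Jc 1 = TbalOf Lc Js 0)
    (hS0 : ∀ j, 1 ≤ j → ∀ c e : Fin 4, HasSum (SD Lc Js Jc j c e) 0)
    (hS1 : ∀ j, 1 ≤ j → ∀ c e ρ : Fin 4, HasSum (fun t : Fin 4 → ℤ => t ρ • SD Lc Js Jc j c e t) 0)
    (hSA : ∀ j, 1 ≤ j → ∀ c e : Fin 4, AbsMoment₂ (SD Lc Js Jc j c e))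
    (hSF : SDInvisible Lc Js Jc μ ν) : D1Sum Lc Js Jc μ ν :=
  fun m hm => secondMomentSum_of_stepRecursionUpTo_wStep Js Jc μ ν hT0 hT1 hS0 hS1 hSA hSF hbase (stepRecursionUpTo_sd Js Jc) m hm

/-- The pair (canonical weight `wStep Lc j`, one-shot kernel `TshotOf Lc Jc j`) is ADMISSIBLE as soon as the one-shot kernel has (T0)/(T1): the
reproduction data and `AbsMoment₂` of `wStep` are an4's theorems, `AbsMoment₂` of `TshotOf` is an2's. [folklore] -/
theorem entryHyps_wStep_tshotOf (Jc : ∀ m : ℕ, JetData 3 (Lc ^ m)) (j : ℕ)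
    (h0 : ∀ c e : Fin 4, HasSum (TshotOf Lc Jc j c e) 0)
    (h1 : ∀ c e ρ : Fin 4, HasSum (fun t : Fin 4 → ℤ => t ρ • TshotOf Lc Jc j c e t) 0) :
    EntryHyps Lc (wStep Lc j) (TshotOf Lc Jc j) :=
  ⟨Nat.pos_of_ne_zero (NeZero.ne Lc), fun κ l => constReproSum_wStep j κ l, fun κ l => linReproSum_wStep j κ l,
    fun κ l => absMoment₂_wStep j κ l, absMoment₂_TshotOf Jc j, h0, h1⟩

/-- **(SD0)/(SD1) FROM THE WARD DATA OF BOTH FAMILIES**: if the step kernels `TbalOf Lc Js j` AND the one-shot kernels `TshotOf Lc Jc m` (`m ≥ 1`) have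
vanishing zeroth and first moments, then so does the full step defect `SD Lc Js Jc j` for every `j ≥ 1` (the transported term inherits them from
`TshotOf Lc Jc j` by an4's `hasSum_dressedEntry_zero` / `hasSum_dressedEntry_first`).  So (SD0)/(SD1) are P5′ for the two families, nothing more. [folklore] -/
theorem sd_wardData_of_families (Js : ℕ → JetData 3 Lc) (Jc : ∀ m : ℕ, JetData 3 (Lc ^ m))
    (hT0 : ∀ j (c e : Fin 4), HasSum (TbalOf Lc Js j c e) 0)
    (hT1 : ∀ j (c e ρ : Fin 4), HasSum (fun t : Fin 4 → ℤ => t ρ • TbalOf Lc Js j c e t) 0)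
    (h𝒯0 : ∀ m, 1 ≤ m → ∀ c e : Fin 4, HasSum (TshotOf Lc Jc m c e) 0)
    (h𝒯1 : ∀ m, 1 ≤ m → ∀ c e ρ : Fin 4, HasSum (fun t : Fin 4 → ℤ => t ρ • TshotOf Lc Jc m c e t) 0) :
    (∀ j, 1 ≤ j → ∀ c e : Fin 4, HasSum (SD Lc Js Jc j c e) 0) ∧
      (∀ j, 1 ≤ j → ∀ c e ρ : Fin 4, HasSum (fun t : Fin 4 → ℤ => t ρ • SD Lc Js Jc j c e t) 0) := by
  refine ⟨fun j hj c e => ?_, fun j hj c e ρ => ?_⟩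
  · have hE := entryHyps_wStep_tshotOf Jc j (h𝒯0 j hj) (h𝒯1 j hj)
    have h := (h𝒯0 (j + 1) (by omega) c e).sub
      (((hasSum_dressedEntry_zero hE c e).mul_left ((Lc : ℝ) ^ 8)).add (hT0 j c e))
    rw [mul_zero, zero_add, sub_zero] at h
    exact h.congr_fun fun z => (sd_apply Js Jc j c e z).symm
  · have hE := entryHyps_wStep_tshotOf Jc j (h𝒯0 j hj) (h𝒯1 j hj)
    have h := (h𝒯1 (j + 1) (by omega) c e ρ).sub
      (((hasSum_dressedEntry_first hE c e ρ).mul_left ((Lc : ℝ) ^ 8)).add (hT1 j c e ρ))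
    rw [mul_zero, zero_add, sub_zero] at h
    refine h.congr_fun fun z => ?_
    rw [sd_apply]
    simp only [zsmul_eq_mul]
    ring

/-- **`D1Sum` FROM P5′ OF BOTH FAMILIES + `hbase` + (SDA) + (SDF)** (the form RULING (R28-1) quotes): the Ward data (T0)/(T1) of the step family and of
the one-shot family (`m ≥ 1`), the base identity, `AbsMoment₂` of the step defect and `SDInvisible Lc Js Jc μ ν` give `D1Sum Lc Js Jc μ ν`. [folklore] -/
theorem d1Sum_of_stepDefect' (Js : ℕ → JetData 3 Lc) (Jc : ∀ m : ℕ, JetData 3 (Lc ^ m)) {μ ν : Fin 4}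
    (hT0 : ∀ j (c e : Fin 4), HasSum (TbalOf Lc Js j c e) 0)
    (hT1 : ∀ j (c e ρ : Fin 4), HasSum (fun t : Fin 4 → ℤ => t ρ • TbalOf Lc Js j c e t) 0)
    (h𝒯0 : ∀ m, 1 ≤ m → ∀ c e : Fin 4, HasSum (TshotOf Lc Jc m c e) 0)
    (h𝒯1 : ∀ m, 1 ≤ m → ∀ c e ρ : Fin 4, HasSum (fun t : Fin 4 → ℤ => t ρ • TshotOf Lc Jc m c e t) 0)
    (hbase : TshotOf Lc Jc 1 = TbalOf Lc Js 0)
    (hSA : ∀ j, 1 ≤ j → ∀ c e : Fin 4, AbsMoment₂ (SD Lc Js Jc j c e))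
    (hSF : SDInvisible Lc Js Jc μ ν) : D1Sum Lc Js Jc μ ν := by
  obtain ⟨hS0, hS1⟩ := sd_wardData_of_families Js Jc hT0 hT1 h𝒯0 h𝒯1
  exact d1Sum_of_stepDefect Js Jc hT0 hT1 hbase hS0 hS1 hSA hSF

/-- **ONE STEP AT THE READ-OUT LEVEL, WITH THE FULL DEFECT** (no hypothesis on the defect beyond `AbsMoment₂`): under P5′ of the one-shot family and
(SDA), `secondMoment (TshotOf Lc Jc (j+1)) μ ν = secondMoment (TshotOf Lc Jc j) μ ν + secondMoment (TbalOf Lc Js j) μ ν + secondMoment (SD Lc Js Jc j) μ ν`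
for every `j ≥ 1` (an4's `m2Tensor_step_of_stepRecursionUpTo` read out by `readout122 μ ν`). [folklore] -/
theorem secondMoment_step_sd (Js : ℕ → JetData 3 Lc) (Jc : ∀ m : ℕ, JetData 3 (Lc ^ m)) (μ ν : Fin 4)
    (h𝒯0 : ∀ m, 1 ≤ m → ∀ c e : Fin 4, HasSum (TshotOf Lc Jc m c e) 0)
    (h𝒯1 : ∀ m, 1 ≤ m → ∀ c e ρ : Fin 4, HasSum (fun t : Fin 4 → ℤ => t ρ • TshotOf Lc Jc m c e t) 0)
    (hSA : ∀ j, 1 ≤ j → ∀ c e : Fin 4, AbsMoment₂ (SD Lc Js Jc j c e)) :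
    ∀ j : ℕ, 1 ≤ j → secondMoment (TshotOf Lc Jc (j + 1)) μ ν
      = secondMoment (TshotOf Lc Jc j) μ ν + secondMoment (TbalOf Lc Js j) μ ν + secondMoment (SD Lc Js Jc j) μ ν := by
  intro j hj
  have hw : AdmissibleTransport Lc (TshotOf Lc Jc) (wStep Lc) := fun j hj => entryHyps_wStep_tshotOf Jc j (h𝒯0 j hj) (h𝒯1 j hj)
  have h := m2Tensor_step_of_stepRecursionUpTo (hTA_TbalOf Js) hSA hw (stepRecursionUpTo_sd Js Jc) j hj
  have h' := congrArg (readout122 μ ν) h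
  simp only [readout122_add, readout122_m2Tensor] at h'
  exact h'

/-- **(SDF) IS EXACTLY THE CONTENT OF `D1Sum`**: given P5′ of both families, the base identity and (SDA), `D1Sum Lc Js Jc μ ν ↔ SDInvisible Lc Js Jc μ ν` — the
read-out-level telescoping binder of RULING (R27) and the single closed clause of RULING (R28-1) are one statement over the jet data. [folklore] -/
theorem d1Sum_iff_sdInvisible (Js : ℕ → JetData 3 Lc) (Jc : ∀ m : ℕ, JetData 3 (Lc ^ m)) {μ ν : Fin 4}
    (hT0 : ∀ j (c e : Fin 4), HasSum (TbalOf Lc Js j c e) 0)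
    (hT1 : ∀ j (c e ρ : Fin 4), HasSum (fun t : Fin 4 → ℤ => t ρ • TbalOf Lc Js j c e t) 0)
    (h𝒯0 : ∀ m, 1 ≤ m → ∀ c e : Fin 4, HasSum (TshotOf Lc Jc m c e) 0)
    (h𝒯1 : ∀ m, 1 ≤ m → ∀ c e ρ : Fin 4, HasSum (fun t : Fin 4 → ℤ => t ρ • TshotOf Lc Jc m c e t) 0)
    (hbase : TshotOf Lc Jc 1 = TbalOf Lc Js 0)
    (hSA : ∀ j, 1 ≤ j → ∀ c e : Fin 4, AbsMoment₂ (SD Lc Js Jc j c e)) :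
    D1Sum Lc Js Jc μ ν ↔ SDInvisible Lc Js Jc μ ν := by
  refine ⟨fun hsum j hj => ?_, fun hSF => d1Sum_of_stepDefect' Js Jc hT0 hT1 h𝒯0 h𝒯1 hbase hSA hSF⟩
  have hstep := secondMoment_step_sd Js Jc μ ν h𝒯0 h𝒯1 hSA j hj
  have hs1 := hsum (j + 1) (by omega)
  have hs0 := hsum j hj
  rw [Finset.sum_range_succ, hs0] at hs1
  linarith

/-- **THE WALL'S STATEMENT FROM (SDF) + `D1Rep`** (RULING (R28-1) composed with §7): the standing data of the road (the two printed Props BY NAME h12/h126,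
base-point labels, `μ ≠ ν`, `N ≠ 0`, `2 ≤ Lc`, window data), (T0)/(T1) of the step family, `hbase`, (SD0)/(SD1)/(SDA) of the step defect, (SDF) and
`D1Rep Lc Jc N μ ν a SL k` give `D1Drift Lc Js N μ ν`.  NO Ward/reflection predicate, NO `D1Tel`, NO transport family in the socket. [folklore] -/
theorem d1Drift_of_stepDefect_D1Rep (a : ℝ) (ha : 0 < a)
    (h12 : B5.Prop12Printed (fam (fun i : ℕ+ × ℕ => ((i.1 : ℕ+) : ℕ)) (fun i => i.1.pos) MvE a ha))
    (h126 : B5.Kernel126_127Printed (kfam (fun i : ℕ+ × ℕ => ((i.1 : ℕ+) : ℕ)) MvE))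
    {SL : Finset L} (hSL : SL.Nonempty) (k : L → Fin 4) {μ ν : Fin 4} (hμν : μ ≠ ν) {N : ℝ} (hN : N ≠ 0) (hL : 2 ≤ Lc)
    (Js : ℕ → JetData 3 Lc) (Jc : ∀ m : ℕ, JetData 3 (Lc ^ m))
    (hT0 : ∀ j (c e : Fin 4), HasSum (TbalOf Lc Js j c e) 0)
    (hT1 : ∀ j (c e ρ : Fin 4), HasSum (fun t : Fin 4 → ℤ => t ρ • TbalOf Lc Js j c e t) 0)
    (hbase : TshotOf Lc Jc 1 = TbalOf Lc Js 0)
    (hS0 : ∀ j, 1 ≤ j → ∀ c e : Fin 4, HasSum (SD Lc Js Jc j c e) 0)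
    (hS1 : ∀ j, 1 ≤ j → ∀ c e ρ : Fin 4, HasSum (fun t : Fin 4 → ℤ => t ρ • SD Lc Js Jc j c e t) 0)
    (hSA : ∀ j, 1 ≤ j → ∀ c e : Fin 4, AbsMoment₂ (SD Lc Js Jc j c e))
    (hSF : SDInvisible Lc Js Jc μ ν)
    {cc : ℝ} {M : ℕ → ℕ} (hc : 1 ≤ cc) (hM : ∀ L : ℕ, 2 ≤ L → 1 ≤ M L ∧ (L : ℝ) ≤ cc * M L) (hML : ∀ L : ℕ, 2 ≤ L → M L ≤ L)
    (hrep : D1Rep Lc Jc N μ ν a SL k) : D1Drift Lc Js N μ ν :=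
  d1Drift_of_d1Sum_D1Rep a ha h12 h126 hSL k hμν hN hL Js Jc (d1Sum_of_stepDefect Js Jc hT0 hT1 hbase hS0 hS1 hSA hSF) hc hM hML hrep

end StepDefectPin

/-! ## §9 (v1.5) (SDA) IS AUTOMATIC — the dressed kernel of patterns with absolutely summable second moments has an absolutely summable
second moment; hence `AbsMoment₂` of the full step defect `SD`, and the (SDA)-free forms of §8

The one structural hypothesis left in §8's sockets, (SDA) `AbsMoment₂ (SD Lc Js Jc j c e)`, reduces to `AbsMoment₂` of the transported entry
`z ↦ dressedEntry (wStep Lc j) (TshotOf Lc Jc j) (Lc•z) a b`.  This section proves the general fact behind it — for `w, T, w'` with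
absolutely summable second moments the two-sided dressed kernel `y ↦ dressedSum w T w' y = Σ'_{(u,x)} w u · T (y+u−x) · w' x` has an absolutely
summable second moment (weight `1 + |y|₁² ≤ 3(1+|u|₁²)(1+|y+u−x|₁²)(1+|x|₁²)`, beta-an5's triple-family engine
`DecimatedMomentSummable.summable_term_of_bound` and the coarse-point regrouping `hasSum_coarse`) — and removes (SDA) from the census:
`D1Sum ⟺ SDInvisible` given P5′ of both families and `hbase` ONLY.  [folklore]; discharges nothing of the wall. -/

section AbsMomentDressed

open Literature.MathematicalPhysics.QuantumFieldTheory.Balaban1983to89.Beta.DecimatedMomentSummable (AbsMoment₂ dressedSum term term_apply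
  hasSum_coarse summable_term_of_bound summable_dressed_fibre summable_of_absMoment₂)
open Literature.MathematicalPhysics.QuantumFieldTheory.Balaban1983to89.Beta.ExpKernelCalculus (l1_natSmul)

/-- `|t + x − u|₁ ≤ |u|₁ + |t|₁ + |x|₁` (an5's `DecimatedMomentLimit.l1_add_le` twice + an2's `OneStepKernelFamily.l1_neg_eq`). [folklore] -/
theorem l1_add_sub_le (u t x : Fin d → ℤ) : l1 (t + x - u) ≤ l1 u + l1 t + l1 x := by
  have h1 : l1 (t + x - u) ≤ l1 (t + x) + l1 (-u) := by
    rw [sub_eq_add_neg]; exact DecimatedMomentLimit.l1_add_le _ _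
  have h2 := DecimatedMomentLimit.l1_add_le t x
  rw [OneStepKernelFamily.l1_neg_eq] at h1
  linarith

/-- THE INTEGER WEIGHT `1 + (Σ_μ |y_μ|)²` and its real value `1 + |y|₁²`. [folklore] -/
def wt2 (y : Fin d → ℤ) : ℤ := 1 + (∑ μ, |y μ|) ^ 2

/-- `(wt2 y : ℝ) = 1 + |y|₁²`. [folklore] -/
theorem cast_wt2 (y : Fin d → ℤ) : ((wt2 y : ℤ) : ℝ) = 1 + l1 y ^ 2 := by
  unfold wt2 l1
  push_cast
  rfl

/-- The elementary inequality behind the weight bound: for `0 ≤ s ≤ a + b + c`, `1 + s² ≤ 3 (1+a²)(1+b²)(1+c²)`. [folklore] -/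
theorem one_add_sq_le_three_mul {a b c s : ℝ} (hs0 : 0 ≤ s) (hs : s ≤ a + b + c) :
    1 + s ^ 2 ≤ 3 * ((1 + a ^ 2) * ((1 + b ^ 2) * (1 + c ^ 2))) := by
  have hs2 : s ^ 2 ≤ (a + b + c) ^ 2 := pow_le_pow_left₀ hs0 hs 2
  have hab : 0 ≤ a ^ 2 * b ^ 2 := by positivity
  have hbc : 0 ≤ b ^ 2 * c ^ 2 := by positivity
  have hac : 0 ≤ a ^ 2 * c ^ 2 := by positivity
  have habc : 0 ≤ a ^ 2 * b ^ 2 * c ^ 2 := by positivity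
  nlinarith [sq_nonneg (a - b), sq_nonneg (b - c), sq_nonneg (a - c)]

/-- The weight bound `|wt2 (t + x − u)| ≤ 3 (1+|u|₁²)(1+|t|₁²)(1+|x|₁²)` in the shape of `summable_term_of_bound`. [folklore] -/
theorem abs_wt2_le (u t x : Fin d → ℤ) :
    |((wt2 (t + x - u) : ℤ) : ℝ)| ≤ 3 * ((1 + l1 u ^ 2) * ((1 + l1 t ^ 2) * (1 + l1 x ^ 2))) := by
  rw [cast_wt2, abs_of_nonneg (by positivity)]
  exact one_add_sq_le_three_mul (l1_nonneg _) (l1_add_sub_le u t x)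

/-- **THE DRESSED KERNEL OF PATTERNS WITH ABSOLUTELY SUMMABLE SECOND MOMENTS HAS AN ABSOLUTELY SUMMABLE SECOND MOMENT**:
`AbsMoment₂ w → AbsMoment₂ T → AbsMoment₂ w' → AbsMoment₂ (dressedSum w T w')`.  Proof: the triple family with the integer weight
`wt2 (t + x − u)` is summable by beta-an5's engine (`summable_term_of_bound` with `B = 3`, window `χ ≡ 1`), regroups to the coarse-point family
`y ↦ wt2 y • dressedSum w T w' y` (`hasSum_coarse`, fibres summable by `summable_dressed_fibre`), and `|wt2 y • d y| = (1+|y|₁²)·|d y|`. [folklore] -/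
theorem absMoment₂_dressedSum {w T w' : (Fin d → ℤ) → ℝ} (hw : AbsMoment₂ w) (hT : AbsMoment₂ T) (hw' : AbsMoment₂ w') :
    AbsMoment₂ (dressedSum w T w') := by
  have hχ : ∀ z : Fin d → ℤ, |(((fun _ => (1 : ℤ)) z : ℤ) : ℝ)| ≤ 1 := fun _ => by rw [Int.cast_one, abs_one]
  have hS : Summable (term (fun _ => (1 : ℤ)) w T w' (fun u t x => wt2 (t + x - u))) :=
    summable_term_of_bound hχ hw hT hw' (B := 3) (fun u t x => abs_wt2_le u t x)
  have hH := hasSum_coarse (fun _ => (1 : ℤ)) w T w' wt2 hS.hasSum (summable_dressed_fibre hw hT hw')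
  have hsum : Summable (fun y => ((wt2 y : ℤ) : ℝ) * dressedSum w T w' y) := by
    refine hH.summable.congr fun y => ?_
    rw [one_mul, zsmul_eq_mul]
  unfold AbsMoment₂
  refine hsum.abs.congr fun y => ?_
  rw [abs_mul, cast_wt2, abs_of_nonneg (by positivity)]

/-- **DECIMATION PRESERVES `AbsMoment₂`**: for `N ≠ 0`, `AbsMoment₂ f → AbsMoment₂ (z ↦ f (N • z))` (`|N•z|₁ = N|z|₁ ≥ |z|₁`, and `z ↦ N•z`
is injective). [folklore] -/
theorem absMoment₂_comp_zsmul {N : ℕ} (hN : N ≠ 0) {f : (Fin d → ℤ) → ℝ} (hf : AbsMoment₂ f) :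
    AbsMoment₂ (fun z => f ((N : ℤ) • z)) := by
  have hinj : Function.Injective (fun z : Fin d → ℤ => (N : ℤ) • z) := by
    intro z z' h
    have hN' : (N : ℤ) ≠ 0 := by exact_mod_cast hN
    funext i
    have hi := congrFun h i
    simp only [Pi.smul_apply, smul_eq_mul] at hi
    exact mul_left_cancel₀ hN' hi
  have hF : Summable (fun z : Fin d → ℤ => (1 + l1 ((N : ℤ) • z) ^ 2) * |f ((N : ℤ) • z)|) := hf.comp_injective hinj
  have hN1 : (1 : ℝ) ≤ N := by exact_mod_cast Nat.one_le_iff_ne_zero.mpr hN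
  refine hF.of_nonneg_of_le (fun z => by positivity) fun z => ?_
  have hl : l1 z ≤ l1 ((N : ℤ) • z) := by
    rw [l1_natSmul]
    nlinarith [l1_nonneg z]
  have hl2 : l1 z ^ 2 ≤ l1 ((N : ℤ) • z) ^ 2 := pow_le_pow_left₀ (l1_nonneg z) hl 2
  exact mul_le_mul_of_nonneg_right (by linarith) (abs_nonneg _)

/-- `AbsMoment₂` is additive (any dimension). [folklore] -/
theorem absMoment₂_add_gen {f g : (Fin d → ℤ) → ℝ} (hf : AbsMoment₂ f) (hg : AbsMoment₂ g) : AbsMoment₂ (fun y => f y + g y) := by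
  unfold AbsMoment₂ at hf hg ⊢
  refine (hf.add hg).of_nonneg_of_le (fun z => by positivity) fun z => ?_
  rw [← mul_add]
  exact mul_le_mul_of_nonneg_left (abs_add_le _ _) (by positivity)

/-- `AbsMoment₂` of a difference (any dimension). [folklore] -/
theorem absMoment₂_sub_gen {f g : (Fin d → ℤ) → ℝ} (hf : AbsMoment₂ f) (hg : AbsMoment₂ g) : AbsMoment₂ (fun y => f y - g y) := by
  unfold AbsMoment₂ at hf hg ⊢
  refine (hf.add hg).of_nonneg_of_le (fun z => by positivity) fun z => ?_
  rw [← mul_add]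
  exact mul_le_mul_of_nonneg_left (abs_sub _ _) (by positivity)

/-- `AbsMoment₂` of the zero pattern (any dimension). [folklore] -/
theorem absMoment₂_zero_gen : AbsMoment₂ (fun _ : Fin d → ℤ => (0 : ℝ)) := by
  unfold AbsMoment₂
  simp only [abs_zero, mul_zero]
  exact summable_zero

/-- `AbsMoment₂` of a finite sum of patterns (any dimension). [folklore] -/
theorem absMoment₂_finset_sum_gen {ι : Type*} (s : Finset ι) {f : ι → (Fin d → ℤ) → ℝ} (h : ∀ i ∈ s, AbsMoment₂ (f i)) :
    AbsMoment₂ (fun y => ∑ i ∈ s, f i y) := by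
  classical
  induction s using Finset.induction_on with
  | empty =>
      simp only [Finset.sum_empty]
      exact absMoment₂_zero_gen
  | insert a s ha ih =>
      have h' := absMoment₂_add_gen (h a (Finset.mem_insert_self a s)) (ih fun i hi => h i (Finset.mem_insert_of_mem hi))
      exact h'.congr fun y => by simp only [Finset.sum_insert ha]

end AbsMomentDressed

section SDAutomatic

open Literature.MathematicalPhysics.QuantumFieldTheory.Balaban1983to89.Beta.OneStepKernelFamily (TshotOf D1Rep hTA_TbalOf absMoment₂_TshotOf)
open Literature.MathematicalPhysics.QuantumFieldTheory.Balaban1983to89.Beta.HessianTelescopingKKT (wStep absMoment₂_wStep)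
open Literature.MathematicalPhysics.QuantumFieldTheory.Balaban1983to89.Beta.DressedMomentNormalisation (dressedEntry)
open Literature.MathematicalPhysics.QuantumFieldTheory.Balaban1983to89.Beta.DecimatedMomentSummable (AbsMoment₂ dressedSum)
open Literature.MathematicalPhysics.QuantumFieldTheory.Balaban1983to89.Beta.VectorTailsLoc (fam kfam)
open Literature.MathematicalPhysics.QuantumFieldTheory.Balaban1983to89.Beta.VectorLegVolumeAdapter (MvE)

variable {Lc : ℕ} [NeZero Lc] {L : Type*}

/-- `AbsMoment₂` of every entry of the dressed matrix kernel `y ↦ dressedEntry w T y a b` from `AbsMoment₂` of the entries of `w` and `T`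
(finite sum over the two inner indices of `absMoment₂_dressedSum`). [folklore] -/
theorem absMoment₂_dressedEntry {D : ℕ} {w T : EKer D} (hw : ∀ κ l, AbsMoment₂ (w κ l)) (hT : ∀ c e, AbsMoment₂ (T c e)) (a b : Fin D) :
    AbsMoment₂ (fun y => dressedEntry w T y a b) := by
  unfold dressedEntry
  refine absMoment₂_finset_sum_gen _ fun c _ => ?_
  exact absMoment₂_finset_sum_gen _ fun e _ => absMoment₂_dressedSum (hw c a) (hT c e) (hw e b)

/-- **`AbsMoment₂` OF THE TRANSPORTED ONE-SHOT KERNEL** `z ↦ Lc^8 · dressedEntry (wStep Lc j) (TshotOf Lc Jc j) (Lc•z) a b` — NO hypothesis (an4's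
`absMoment₂_wStep`, an2's `absMoment₂_TshotOf`, `absMoment₂_dressedEntry`, decimation). [folklore] -/
theorem absMoment₂_transport (Jc : ∀ m : ℕ, JetData 3 (Lc ^ m)) (j : ℕ) (a b : Fin 4) :
    AbsMoment₂ (fun z : Fin 4 → ℤ => (Lc : ℝ) ^ 8 * dressedEntry (wStep Lc j) (TshotOf Lc Jc j) ((Lc : ℤ) • z) a b) := by
  have h := absMoment₂_comp_zsmul (NeZero.ne Lc)
    (absMoment₂_dressedEntry (w := wStep Lc j) (T := TshotOf Lc Jc j) (fun κ l => absMoment₂_wStep (Lc := Lc) j κ l)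
      (absMoment₂_TshotOf Jc j) a b)
  exact HessianTelescopingKKT.absMoment₂_const_mul' h _

/-- **(SDA) IS AUTOMATIC**: every entry of the full step defect `SD Lc Js Jc j` has an absolutely summable second moment, for ALL jet data and all
`j` — no Ward data, no hypothesis. [folklore] -/
theorem absMoment₂_sd (Js : ℕ → JetData 3 Lc) (Jc : ∀ m : ℕ, JetData 3 (Lc ^ m)) (j : ℕ) (c e : Fin 4) :
    AbsMoment₂ (SD Lc Js Jc j c e) := by
  have h := absMoment₂_sub_gen (absMoment₂_TshotOf Jc (j + 1) c e)
    (absMoment₂_add_gen (absMoment₂_transport Jc j c e) (hTA_TbalOf Js j c e))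
  exact h.congr fun z => by rw [sd_apply]

/-- **`D1Sum ⟺ SDInvisible` GIVEN P5′ OF BOTH FAMILIES AND `hbase` ONLY** ((SDA) discharged by `absMoment₂_sd`): the read-out-level telescoping binder of
RULING (R27) IS the single closed clause (SDF) of RULING (R28-1). [folklore] -/
theorem d1Sum_iff_sdInvisible' (Js : ℕ → JetData 3 Lc) (Jc : ∀ m : ℕ, JetData 3 (Lc ^ m)) {μ ν : Fin 4}
    (hT0 : ∀ j (c e : Fin 4), HasSum (TbalOf Lc Js j c e) 0)
    (hT1 : ∀ j (c e ρ : Fin 4), HasSum (fun t : Fin 4 → ℤ => t ρ • TbalOf Lc Js j c e t) 0)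
    (h𝒯0 : ∀ m, 1 ≤ m → ∀ c e : Fin 4, HasSum (TshotOf Lc Jc m c e) 0)
    (h𝒯1 : ∀ m, 1 ≤ m → ∀ c e ρ : Fin 4, HasSum (fun t : Fin 4 → ℤ => t ρ • TshotOf Lc Jc m c e t) 0)
    (hbase : TshotOf Lc Jc 1 = TbalOf Lc Js 0) :
    D1Sum Lc Js Jc μ ν ↔ SDInvisible Lc Js Jc μ ν :=
  d1Sum_iff_sdInvisible Js Jc hT0 hT1 h𝒯0 h𝒯1 hbase (fun j _ c e => absMoment₂_sd Js Jc j c e)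

/-- **`D1Sum` FROM P5′ OF BOTH FAMILIES + `hbase` + (SDF)** — the census form of RULING (R28-1) with (SDA) gone. [folklore] -/
theorem d1Sum_of_sdInvisible (Js : ℕ → JetData 3 Lc) (Jc : ∀ m : ℕ, JetData 3 (Lc ^ m)) {μ ν : Fin 4}
    (hT0 : ∀ j (c e : Fin 4), HasSum (TbalOf Lc Js j c e) 0)
    (hT1 : ∀ j (c e ρ : Fin 4), HasSum (fun t : Fin 4 → ℤ => t ρ • TbalOf Lc Js j c e t) 0)
    (h𝒯0 : ∀ m, 1 ≤ m → ∀ c e : Fin 4, HasSum (TshotOf Lc Jc m c e) 0)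
    (h𝒯1 : ∀ m, 1 ≤ m → ∀ c e ρ : Fin 4, HasSum (fun t : Fin 4 → ℤ => t ρ • TshotOf Lc Jc m c e t) 0)
    (hbase : TshotOf Lc Jc 1 = TbalOf Lc Js 0) (hSF : SDInvisible Lc Js Jc μ ν) : D1Sum Lc Js Jc μ ν :=
  (d1Sum_iff_sdInvisible' Js Jc hT0 hT1 h𝒯0 h𝒯1 hbase).2 hSF

/-- **THE WALL'S STATEMENT FROM P5′ (BOTH FAMILIES) + `hbase` + (SDF) + `D1Rep`** (+ the standing road data) — the (SDA)-free form of
`d1Drift_of_stepDefect_D1Rep`. [folklore] -/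
theorem d1Drift_of_sdInvisible_D1Rep (a : ℝ) (ha : 0 < a)
    (h12 : B5.Prop12Printed (fam (fun i : ℕ+ × ℕ => ((i.1 : ℕ+) : ℕ)) (fun i => i.1.pos) MvE a ha))
    (h126 : B5.Kernel126_127Printed (kfam (fun i : ℕ+ × ℕ => ((i.1 : ℕ+) : ℕ)) MvE))
    {SL : Finset L} (hSL : SL.Nonempty) (k : L → Fin 4) {μ ν : Fin 4} (hμν : μ ≠ ν) {N : ℝ} (hN : N ≠ 0) (hL : 2 ≤ Lc)
    (Js : ℕ → JetData 3 Lc) (Jc : ∀ m : ℕ, JetData 3 (Lc ^ m))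
    (hT0 : ∀ j (c e : Fin 4), HasSum (TbalOf Lc Js j c e) 0)
    (hT1 : ∀ j (c e ρ : Fin 4), HasSum (fun t : Fin 4 → ℤ => t ρ • TbalOf Lc Js j c e t) 0)
    (h𝒯0 : ∀ m, 1 ≤ m → ∀ c e : Fin 4, HasSum (TshotOf Lc Jc m c e) 0)
    (h𝒯1 : ∀ m, 1 ≤ m → ∀ c e ρ : Fin 4, HasSum (fun t : Fin 4 → ℤ => t ρ • TshotOf Lc Jc m c e t) 0)
    (hbase : TshotOf Lc Jc 1 = TbalOf Lc Js 0) (hSF : SDInvisible Lc Js Jc μ ν)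
    {cc : ℝ} {M : ℕ → ℕ} (hc : 1 ≤ cc) (hM : ∀ L : ℕ, 2 ≤ L → 1 ≤ M L ∧ (L : ℝ) ≤ cc * M L) (hML : ∀ L : ℕ, 2 ≤ L → M L ≤ L)
    (hrep : D1Rep Lc Jc N μ ν a SL k) : D1Drift Lc Js N μ ν :=
  d1Drift_of_d1Sum_D1Rep a ha h12 h126 hSL k hμν hN hL Js Jc (d1Sum_of_sdInvisible Js Jc hT0 hT1 h𝒯0 h𝒯1 hbase hSF) hc hM hML hrep

end SDAutomatic

end Literature.MathematicalPhysics.QuantumFieldTheory.Balaban1983to89.Beta.StepDriftWitness
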